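import Literature.MathematicalPhysics.QuantumFieldTheory.Balaban1983to89.B15Claim189PinAtRecord
import Literature.MathematicalPhysics.QuantumFieldTheory.Balaban1983to89.B14FlowStep
import Literature.MathematicalPhysics.QuantumFieldTheory.Balaban1983to89.FlowStepRuns

/-!
# `Balaban1983to89.B15Claim189FlowAtRecord` — YM-DAG node N12 · [Balaban1989LargeFieldI] CMP **122** (1989) 175–202, (1.89) p. 198 with p. 199's units
# inequality *"ε_kη² ≦ (1 + β₀)(k − j)^{1/2}L^{−2(k−j)}ε_j(L^{k−j}η)²"* and the numerics `0 ≦ ε_i ≦ 1/10`: THE FLOW-SIDE AND THRESHOLD-SIDE INPUTS OF (1.89)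
# AT NODE 00's RECORDS ARE THEOREMS OF THE RUN'S COUPLING WINDOW — the [III] (2.8) relation `ε_k ≦ (1+β₀)(k−j)^{1/2}ε_j` and the signs ∕ size of the
# thresholds `ε_j = epsOfRecord θ.ν (gOfRecord₁₀ θ P) j` (module 4's located hypotheses `hflow`, `hε0`, `hε1` of `wDisplays₁₀_pinD189_of_rPrimePin_leaves`)
# DISCHARGED from `Step.InInterval θ.γ k (gOfRecord₁₀ θ P)` (the run's couplings in `]0, γ]` up to the step), the printed upper bound `β ≦ β′` ALONG THE RUN'S OWN
# HISTORY and the numerics `B14FlowStep.SmallnessFor γ β′ β₀ L p₀` (+ `A₀ ≧ 0`, `γA₀(log γ⁻²)^{p₀} ≦ 1/10`); with a BOUNDED-LEVEL form of p29's one-theorem assembly of (1.89)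

statement-level bookkeeping over published theorems with citation tags; kernel-checked compositions of tree theorems; nothing here is a claim about the Yang–Mills
mass gap.

CITATION HEADER (lean-in-tree rule).  Sources: [Balaban1989LargeFieldI] («[IV]») (1.89) p. 198, pp. 199–200 (p. 199: *"using the inequality ε_kη² ≦ (1 + β₀)
(k − j)^{1/2}L^{−2(k−j)}ε_j(L^{k−j}η)² ≦ L^{−(k−j)}ε_j(L^{k−j}η)² for j < k"*); [Balaban1988Convergent] («[III]») (2.4) p. 255 (`ε_k = g_kA₀(log g_k⁻²)^{p₀}`), (2.8)
p. 256 (*"ε_n ≦ (1+β₀)(n−m)^{1/2}ε_m"*); [Balaban1987RG1] («[I]») (0.18)–(0.20) pp. 255–256 (the forward recursion of the couplings), §1 p. 264 (*"uniformly bounded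
on this interval"*: `β ≦ β′`).  Seat `pub-ymgap-dag-n12-e` (YM-PLAN Track A, HUMAN RULING D-0062; director-ym R134 row N12 s3 «the (1.80)∕(1.89) + 𝐑′ (1.99)–(1.100)
p. 201 chain»), generation 2, module 5 of the lineage (modules 1–4: `B15RPrime1100OfRep`, `B15RPrime1100AtRecord`, `Thm/BalabanUVNodesN12RPrimePin`,
`B15Claim189PinAtRecord`).  BY NAME and UNCHANGED: `B14FlowStep` (`SmallnessFor`, `flowIneq28a_signfree`, `eps_profile_mono`, `log_inv_sq_nonneg`), `FlowStepRuns`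
(`genSeq`, `genFlow`, `modelOf`, `satisfiesRG_of_inInterval`), `FlowStep` (`HBeta`, `prefixOf`, `Box`, `BetaUpperH`), `DagBinding.update_prefixOf_last`, def-R's
`Node00.epsOfRecord`, def-T's `Node00.gOfRecord₁₀ ∕ betaOfRecord₁₀` (`Node00.Record10`), p29's `B15Claim189Assembly` (`Setting189`, `new189`, `chiPP`, `X`, `dom`, `domK`,
`half`, `Ω_antitone`, `half_lt_of_new189`, `hlast_of_largeM`, `dom_h ∕ dom_k ∕ dom_j`), r12's `B15Bounds199.chainD`, `B15Claim189Cases.lines124N_of_bounds`,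
`B15Ineq196Proof.ineq198 ∕ ineq196_first_of_191_195`, `B15Chi124DetSets.chi124_top_of_lines ∕ E124`, module 4 `B15Claim189PinAtRecord` (`Sit189`, `D189OfRecord`,
`ResidW.pinD189`), module 2 `B15RPrime1100AtRecord.wDisplays₁₀_of_rPrimePin`.

WHY THIS FILE.  After module 4 the (1.89) display at a D189-pinned layer is REDUCED (p29's `claim189_assembly_of_flow`) to its printed leaves + located inputs
read at the record's objects.  Three of those inputs are functions of THE RECORD ALONE (not of the residual situation `σ`): the [III] (2.8) flow relation
`hflow` for the thresholds `ε_j = epsOfRecord θ.ν (gOfRecord₁₀ θ P) j` of the run's generated coupling history, and the numerics `hε0 : 0 ≦ ε_i`, `hε1 : ε_i ≦ 1/10`.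
The tree HAS (2.8) along any flow solving (0.20) in the window with `β ≦ β′` (`B14FlowStep.flowIneq28a_signfree`, sign-free), and (0.20) is DERIVED along
in-window runs of the forward-generated history (`FlowStepRuns.satisfiesRG_of_inInterval`).  So at the record these three inputs follow from: the run's window
`Step.InInterval θ.γ k (gOfRecord₁₀ θ P)`, the bound `β_j(g_0,…,g_j) ≦ β′` along the run's own history (⇐ the box bound `FlowStep.BetaUpperH β′ γ β` — the
binder N24's glue and K1′ carry), `SmallnessFor`, `0 ≦ A₀`, and ONE numeric clause `γA₀(log γ⁻²)^{p₀} ≦ 1/10` for `hε1`.  One typing point forces §2: p29's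
assembly asks `hε0 ∕ hε1` at EVERY level `i : ℕ`, but the record's history `genSeq β g₀` is print's only inside the window (beyond it the forward recursion is
conventional: `solveCoupling` returns `0` or an uncontrolled positive root), so `∀ i` is NOT a theorem of any record; print uses the thresholds at the levels
`h ≦ i ≦ k` of the situation only — §2 re-proves p29's assembly with the ε-numerics asked THERE (same proof, the units `E_i` truncated off `[h, k]` inside the
call to r12's `lines124N_of_bounds`).

WHAT THIS FILE PROVES (theorems only; 0 `def`, 0 `sorry`, 0 `instance`, 0 `notation`).
§1 FLOW NUMERICS ALONG A GENERATED HISTORY `g = genSeq β g₀` IN THE WINDOW `]0, γ]` up to level `n`: `satisfiesRG_genFlow_of_inInterval` ((0.20) up to `n`),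
   `beta_genFlow_succ_apply` (`β_{j+1}(g_j) = β j (g_0,…,g_j)`), `epsOfRecord_genSeq_eq_epsK` (`rfl`), **`epsOfRecord_flow28a_of_inInterval`** ((2.8) first member:
   `ε_{n′} ≦ (1+β₀)(n′−m)^{1/2}ε_m`, `m < n′ ≦ n`), `betaAlongHistory_le_of_betaUpperH` (box bound ⇒ bound along the history), `epsOfRecord_nonneg_of_inInterval`,
   `epsOfRecord_pos_of_inInterval`, `epsOfRecord_le_profile_of_inInterval` (`ε_i ≦ γA₀(log γ⁻²)^{p₀}`), `epsOfRecord_le_of_inInterval`.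
§2 **`claim189_assembly_bdd`**, `hscale_of_flow_bdd`, **`claim189_assembly_of_flow_bdd`** — p29's `claim189_assembly` ∕ `hscale_of_flow` ∕ `claim189_assembly_of_flow`
   with `hε0 ∕ hε1` asked on `h ≦ i ≦ k` ONLY (everything else verbatim).
§3 AT NODE 00's RECORD (`θ : Stage9Params`, run `P`, situation `σ : Sit189 F N P.K`): `epsOfRecord₁₀_flow28a`, **`hflow_D189OfRecord_of_inInterval`** (module 4's `hflow`
   DISCHARGED), `eps_D189OfRecord_nonneg_of_inInterval`, `eps_D189OfRecord_le_of_inInterval` (`hε0 ∕ hε1` on `[h, k]` DISCHARGED); **`claim189_D189OfRecord_of_inInterval`**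
   ((1.89) at the pinned letters from the leaves + geometry + the WINDOW); **`wDisplays₁₀_pinD189_of_rPrimePin_leaves_inInterval`** (module 4's display theorem with
   `hflow ∕ hε0 ∕ hε1 ∕ hβ₀0` replaced by window + β′-along-the-history + `SmallnessFor` + `A₀ ≧ 0` + the `1/10` clause), `…_of_betaUpperH` (the same from the box bound).
§4 THE WINDOW AND THE β′ BOUND ARE LEAVES OF THE SAME RUN (`DagBinding.leavesP w P`: `smallCouplings`, `betaSmoothBounded`) at a world bound to the record's
   construction: `inInterval_gOfRecord₁₀_of_smallCouplings`, `betaAlongHistory_le_of_betaSmoothBounded`, **`hflow_D189OfRecord_of_leaves`**, `flow_eq_genFlow_of_C_eq` (A2, `rfl`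
   face at `datumOfRecord₁₀`).  LOCATED (design input, nothing asserted): `Dag.B15_main ℓ = ℓ.b5 → ℓ.b7 → ℓ.b8 → ℓ.b10 → ℓ.b11 → ℓ.rBasicStep` does NOT carry
   `ℓ.smallCouplings ∕ ℓ.betaSmoothBounded`, so a per-run [IV] leaf at a pinned layer has no window source inside `S_N12` as cut; the (1.89) flow inputs are
   exactly those two leaves (+ numerics).
§5 (v1.1) AT ADMISSIBLE PARAMETERS (`0 < A₀` is a clause of `Stage7Params.Admissible`): `A₀_pos_of_admissible`, `epsOfRecord₁₀_pos_of_admissible` (the shape of def-T's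
   displayed `hε` slots, read off the window), `epsOfRecord₁₀_nonneg_of_admissible`, `hflow_D189OfRecord_of_admissible`, `hflow_D189OfRecord_of_leaves_of_admissible`.
§6 (v1.2) **`claim189_D189OfRecord_of_leaves`** — (1.89) at the pinned letters from the run's `smallCouplings` + `betaSmoothBounded` LEAVES (+ admissibility,
   numerics, geometry, leaves (1.90)–(1.97), (1.80)): the consumer shape of LOCATED (L1).
   β-FREE VARIANT through the `flowControl` leaf ((2.6), `B14.FlowIneq26`; an antecedent of `Dag.B14_main` already): `epsOfRecord_flow28a_of_flowIneq26`,
   `flowIneq26_gOfRecord₁₀_of_flowControl`, `hflow_D189OfRecord_of_flowControl_leaves`, **`claim189_D189OfRecord_of_flowControl_leaves`**.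

HONEST FRAMING.  Count-neutral: three located inputs of the (1.89) display become theorems of the record's coupling window and print's β′ bound; the leaves
(1.90)–(1.97), (1.80), Proposition 1, positive mass, the situation's numerics ∕ geometry stay displayed; NO new estimate of Bałaban's is asserted (the (2.8)
arithmetic is the cell's `B14FlowStep`, kernel-proved); N12 NOT discharged; one finite four-torus programme at fixed `ε`, Bałaban AS PRINTED with locators;
nothing continuum ∕ ℝ⁴ ∕ OS ∕ mass gap ∕ Clay.  No `sorry`, no `axiom`, no `instance`, no `notation`.
-/

noncomputable section

open scoped BigOperators
open MeasureTheory

namespace Literature.MathematicalPhysics.QuantumFieldTheory.Balaban1983to89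

namespace B15Claim189FlowAtRecord

open FlowStep (HBeta prefixOf Box mem_box BetaUpperH)
open FlowStepRuns (genSeq genFlow modelOf modelOf_forwardGenerated modelOf_haltsOutside modelOf_curries satisfiesRG_of_inInterval)
open B14FlowStep (SmallnessFor flowIneq28a_signfree eps_profile_mono log_inv_sq_nonneg)
open DagBinding (update_prefixOf_last)
open Node00

/-! ## §1. Flow numerics along a generated history in the window -/

section FlowNumerics

/-- The couplings of the generated flow ARE the generated history (`rfl`). [cite: Balaban1987RG1, (0.18)–(0.20) pp.255–256 (bookkeeping)] -/
theorem genFlow_g_eq_genSeq (β : HBeta) (g0 : ℝ) : (genFlow β g0).g = genSeq β g0 := rfl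

/-- **(0.20) up to level `n` along a generated history that stays in `]0, γ]` up to `n`** — `FlowStepRuns.satisfiesRG_of_inInterval` at the canonical
construction `modelOf β` read at the run `⟨n, 0, g₀⟩` (whose flow IS `genFlow β g₀`). [cite: Balaban1987RG1, (0.20) p.256] -/
theorem satisfiesRG_genFlow_of_inInterval (β : HBeta) (g0 : ℝ) {γ : ℝ} {n : ℕ} (hI : Step.InInterval γ n (genSeq β g0)) :
    (genFlow β g0).SatisfiesRG n :=
  satisfiesRG_of_inInterval (modelOf_forwardGenerated β) (modelOf_haltsOutside β) (modelOf_curries β) ⟨n, 0, g0⟩ (γ := γ) hI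

/-- The run-wise β-function of the generated flow at the run's own coupling IS the history-dependent `β j (g_0, …, g_j)` (the carver's dictionary,
`DagBinding.update_prefixOf_last`). [cite: Balaban1987RG1, (1.22) p.264 (bookkeeping)] -/
theorem beta_genFlow_succ_apply (β : HBeta) (g0 : ℝ) (j : ℕ) :
    (genFlow β g0).β (j + 1) (genSeq β g0 j) = β j (prefixOf (genSeq β g0) j) := by
  show β j (Function.update (prefixOf (genSeq β g0) j) (Fin.last j) (genSeq β g0 j)) = _
  rw [update_prefixOf_last]

/-- def-R's thresholds of record along a generated history ARE the cell's `Setup.epsK` of the generated flow (`rfl`). [cite: Balaban1988Convergent, (2.4) p.255 (bookkeeping)] -/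
theorem epsOfRecord_genSeq_eq_epsK (ν : Stage7Numerics) (β : HBeta) (g0 : ℝ) (k : ℕ) :
    epsOfRecord ν (genSeq β g0) k = epsK ν.A₀ ν.p₀ (genFlow β g0) k := rfl

/-- **[III] (2.8), FIRST MEMBER, ALONG A GENERATED HISTORY IN THE WINDOW**: if `g = genSeq β g₀` stays in `]0, γ]` up to level `n` and `β j (g_0,…,g_j) ≦ β′` for
`j < n`, then `ε_{n′} ≦ (1+β₀)(n′−m)^{1/2}ε_m` for all `m < n′ ≦ n` (`ε_j = epsOfRecord ν g j`; `SmallnessFor γ β′ β₀ L p₀`, `0 ≦ A₀`) — `B14FlowStep.flowIneq28a_signfree`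
(sign-free: no sign or monotonicity of the couplings) fed by §1's (0.20). [cite: Balaban1988Convergent, (2.8) p.256] -/
theorem epsOfRecord_flow28a_of_inInterval (ν : Stage7Numerics) (hA₀ : 0 ≤ ν.A₀) {γ β' β₀ : ℝ} {L : ℕ} (S : SmallnessFor γ β' β₀ L ν.p₀)
    (β : HBeta) (g0 : ℝ) {n : ℕ} (hI : Step.InInterval γ n (genSeq β g0)) (hub : ∀ j, j < n → β j (prefixOf (genSeq β g0) j) ≤ β')
    {m n' : ℕ} (hmn : m < n') (hn' : n' ≤ n) :
    epsOfRecord ν (genSeq β g0) n' ≤ (1 + β₀) * Real.sqrt ((n' : ℝ) - m) * epsOfRecord ν (genSeq β g0) m := by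
  have hub' : ∀ j, j < n → (genFlow β g0).β (j + 1) ((genFlow β g0).g j) ≤ β' := fun j hj =>
    (beta_genFlow_succ_apply β g0 j).le.trans (hub j hj)
  exact flowIneq28a_signfree (genFlow β g0) n S hA₀ (satisfiesRG_genFlow_of_inInterval β g0 hI) hI hub' hmn hn'

/-- **The bound along the history from the BOX bound**: `β ≦ β′` on the boxes `]0, γ]^{j+1}` (`FlowStep.BetaUpperH`, [I] p. 264 *"uniformly bounded on this
interval"*) and the window up to `n` give `β j (g_0,…,g_j) ≦ β′` for `j < n`. [cite: Balaban1987RG1, §1 p.264] -/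
theorem betaAlongHistory_le_of_betaUpperH {γ β' : ℝ} {β : HBeta} (hup : BetaUpperH β' γ β) {g : ℕ → ℝ} {n : ℕ} (hI : Step.InInterval γ n g) :
    ∀ j, j < n → β j (prefixOf g j) ≤ β' := fun j hj =>
  hup j _ (mem_box.mpr fun i => hI i (by have := i.isLt; omega))

/-- **The sign of the thresholds in the window**: `0 < g_i ≦ γ ≦ 1` and `0 ≦ A₀` give `0 ≦ ε_i = g_iA₀(log g_i⁻²)^{p₀}` for `i ≦ n`.
[cite: Balaban1988Convergent, (2.4) p.255] -/
theorem epsOfRecord_nonneg_of_inInterval (ν : Stage7Numerics) (hA₀ : 0 ≤ ν.A₀) {γ : ℝ} (hγ1 : γ ≤ 1) {g : ℕ → ℝ} {n : ℕ}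
    (hI : Step.InInterval γ n g) {i : ℕ} (hi : i ≤ n) : 0 ≤ epsOfRecord ν g i := by
  obtain ⟨h0, hγ⟩ := hI i hi
  unfold epsOfRecord p0Profile
  exact mul_nonneg h0.le (mul_nonneg hA₀ (pow_nonneg (log_inv_sq_nonneg h0 (hγ.trans hγ1)) _))

/-- … and with `0 < A₀`, `γ < 1` they are POSITIVE (def-R's `Node00.epsOfRecord_pos` in the window). [cite: Balaban1988Convergent, (2.4) p.255] -/
theorem epsOfRecord_pos_of_inInterval (ν : Stage7Numerics) (hA : 0 < ν.A₀) {γ : ℝ} (hγ1 : γ < 1) {g : ℕ → ℝ} {n : ℕ}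
    (hI : Step.InInterval γ n g) {i : ℕ} (hi : i ≤ n) : 0 < epsOfRecord ν g i :=
  epsOfRecord_pos ν hA (hI i hi).1 ((hI i hi).2.trans_lt hγ1)

/-- **The size of the thresholds in the window**: `ε_i ≦ γA₀(log γ⁻²)^{p₀}` for `i ≦ n` — the profile `x ↦ xA₀(log x⁻²)^{p₀}` is monotone on `]0, γ]` once
`2p₀ ≦ log γ⁻²` (`B14FlowStep.eps_profile_mono`). [cite: Balaban1988Convergent, (2.4) p.255, (2.7) p.255] -/
theorem epsOfRecord_le_profile_of_inInterval (ν : Stage7Numerics) (hA₀ : 0 ≤ ν.A₀) {γ : ℝ} (hγ1 : γ < 1)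
    (hp : 2 * (ν.p₀ : ℝ) ≤ Real.log (γ ^ 2)⁻¹) {g : ℕ → ℝ} {n : ℕ} (hI : Step.InInterval γ n g) {i : ℕ} (hi : i ≤ n) :
    epsOfRecord ν g i ≤ γ * p0Profile ν.A₀ ν.p₀ γ :=
  eps_profile_mono hA₀ (hI i hi).1 (hI i hi).2 hγ1 hp

/-- … hence `ε_i ≦ c` for `i ≦ n` under `SmallnessFor γ β′ β₀ L p₀` (its `4p₀ + 2 ≦ log γ⁻²`, `γ < 1`) and ONE numeric clause `γA₀(log γ⁻²)^{p₀} ≦ c` (print's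
`ε_i ≦ 1/10` is `c = 1/10`). [cite: Balaban1988Convergent, (2.4) p.255; Balaban1989LargeFieldI, p.199 (the numerics `ε_h ≦ 1/10`)] -/
theorem epsOfRecord_le_of_inInterval (ν : Stage7Numerics) (hA₀ : 0 ≤ ν.A₀) {γ β' β₀ : ℝ} {L : ℕ} (S : SmallnessFor γ β' β₀ L ν.p₀) {c : ℝ}
    (hc : γ * p0Profile ν.A₀ ν.p₀ γ ≤ c) {g : ℕ → ℝ} {n : ℕ} (hI : Step.InInterval γ n g) {i : ℕ} (hi : i ≤ n) : epsOfRecord ν g i ≤ c := by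
  have hp : 2 * (ν.p₀ : ℝ) ≤ Real.log (γ ^ 2)⁻¹ := by
    have := S.h27a
    have hp0 : (0 : ℝ) ≤ ν.p₀ := Nat.cast_nonneg _
    linarith
  exact (epsOfRecord_le_profile_of_inInterval ν hA₀ S.γ_lt_one hp hI hi).trans hc

end FlowNumerics

/-! ## §2. p29's one-theorem assembly of (1.89) with the ε-numerics asked on the levels `h ≦ i ≦ k` only -/

section BoundedAssembly

open B15.BasicStep B15.PrelimIntegrations B15Chi124DetSets B15Claim189Cases B15Ineq196Proof B15Bounds199 B8Eq17ClassAkV1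
open GaugeField
open B15Claim189Assembly (Setting189 new189 chiPP X dom domK domH domJ half Ω_antitone half_lt_of_new189 hlast_of_largeM dom_h dom_k dom_j)

variable {P : Params} {G C ι : Type*}

/-- p. 199's units inequality from the [III] flow relation, **with `ε_j ≧ 0` asked on `h ≦ j ≦ k` only** (p29's `hscale_of_flow`, r12's `chainD`).
[cite: Balaban1989LargeFieldI, p.199] -/
theorem hscale_of_flow_bdd (D : Setting189 P G C ι) (hL : 2 ≤ D.L) {β₀ : ℝ} (hβ₀0 : 0 ≤ β₀) (hβ₀ : β₀ ≤ 1 / 2)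
    (hε0 : ∀ i, D.h ≤ i → i ≤ D.k → 0 ≤ D.ε i)
    (hflow : ∀ j, D.h ≤ j → j < D.k → D.ε D.k ≤ (1 + β₀) * Real.sqrt ((D.k - j : ℕ) : ℝ) * D.ε j) :
    ∀ j, D.h ≤ j → j < D.k → D.ε D.k * D.η ^ 2 ≤ (D.L ^ (D.k - j))⁻¹ * E124 D.ε D.L D.η D.k j := by
  intro j hj hjk
  obtain ⟨h1, h2⟩ := chainD (D.k - j) (by omega) (η := D.η) hL hβ₀0 hβ₀ (hε0 j hj hjk.le) (hflow j hj hjk)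
  have h3 := h1.trans h2
  unfold E124
  simpa [mul_assoc] using h3

variable [GaugeGroup G]

/-- **(1.89), THE PROVED PART, AS ONE KERNEL THEOREM — BOUNDED-LEVEL FORM**: p29's `claim189_assembly` VERBATIM except that the numerics `0 ≦ ε_i ≦ 1/10` are
asked at the levels `h ≦ i ≦ k` of the situation only (print, p. 199: the thresholds `ε_h`, `ε_j` (`h ≦ j ≦ k`), `ε_k` are the only ones that occur).  Same
proof: `ineq196_first_of_191_195` on the half domain, `ineq198` on the ℍ-domains, `lines124N_of_bounds` (fed with the units `E_i` TRUNCATED to `0` off `[h, k]`,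
where they are never read), `chi124_top_of_lines`. [cite: Balaban1989LargeFieldI, (1.89) p.198, pp.199–200] -/
theorem claim189_assembly_bdd (D : Setting189 P G C ι) (hhk : D.h ≤ D.k₀) (hk : D.k₀ + 2 ≤ D.k)
    (hΩ : ∀ i, D.Ω (i + 1) ⊆ D.Ω i) (hΩtop : D.Ω D.k ⊆ D.Ω (D.k + 1))
    -- numerics as printed; the ε-numerics on the levels of the situation only
    (hα : D.α = 1 / 12) (hβ0 : 0 ≤ D.β) (hβ : D.β ≤ 1 / 4) (hL₀ : 2 ≤ D.L₀) (hL₀L : D.L₀ ^ 2 ≤ D.L)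
    (hε0 : ∀ i, D.h ≤ i → i ≤ D.k → 0 ≤ D.ε i) (hε1 : ∀ i, D.h ≤ i → i ≤ D.k → D.ε i ≤ 1 / 10)
    (hB : 0 ≤ D.O1 * D.B₃ * D.B₅ * D.M ^ 5) (hδ : 0 ≤ D.δ) (hdist : ∀ p, 0 ≤ D.dist p)
    -- p. 200: "with an increased O(1)", "if O(1)B₃B₅M⁵L₀^{−2(N₀−1)} ≦ 1/4"
    {X' : ℝ} (hX' : ∀ j, 2 + X D j ≤ X') (hsmall : X' * ((D.L₀ ^ 2) ^ (D.k - D.k₀ - 1))⁻¹ ≤ 1 / 4)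
    -- p. 200: "We have j = k" and "Making [the last term] smaller than α" on Ω_m∖Ω_{m+1}, k₀ < m < k
    (hjEqK : ∀ m, D.k₀ < m → m < D.k → D.Ω m \ D.Ω (m + 1) ⊆ domK D)
    (hlast : ∀ m, D.k₀ < m → m < D.k → ∀ p ∈ plaqsOf (D.Ω m \ D.Ω (m + 1)),
      X D D.k * Real.exp (-D.δ * D.dist p) ≤ D.α)
    -- p. 199: the [III] flow inequality
    (hscale : ∀ j, D.h ≤ j → j < D.k → D.ε D.k * D.η ^ 2 ≤ (D.L ^ (D.k - j))⁻¹ * E124 D.ε D.L D.η D.k j)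
    -- (1.88): the cube cover of the half domain
    (hbox : ∀ p ∈ plaqsOf (half D), D.boxOf p ∈ D.halfcubes ∧ p ∈ D.plaqT (D.boxOf p))
    -- the leaves (1.90)–(1.91), (1.93)–(1.95) on the half domain
    (L91h : ∀ U, new189 D U → ∀ p ∈ plaqsOf (half D),
      Ineq191 (dist1 (plaqHol (D.Upp U) p)) (D.devV'' U p) D.α ((D.L ^ D.h)⁻¹) (D.ε D.h) (E124 D.ε D.L D.η D.k D.h))
    (L95 : ∀ U, new189 D U → ∀ p ∈ plaqsOf (half D),
      Ineq195 (D.devV'' U p) (dist1 (plaqHol (D.Uhalf U (D.boxOf p)) p)) D.α ((D.L ^ D.h)⁻¹) (D.ε D.h)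
        (E124 D.ε D.L D.η D.k D.h))
    -- the leaves of p. 199 on the j-th ℍ-domain: (1.91)[h ↦ j] twice and (1.80)
    (L91 : ∀ U, new189 D U → ∀ j, D.h ≤ j → j ≤ D.k → ∀ p ∈ plaqsOf (dom D j),
      Ineq191 (dist1 (plaqHol (D.Upp U) p)) (D.dev97 U p) D.α ((D.L ^ j)⁻¹) (D.ε j) (E124 D.ε D.L D.η D.k j))
    (L97 : ∀ U, new189 D U → ∀ j, D.h ≤ j → j ≤ D.k → ∀ p ∈ plaqsOf (dom D j),
      Ineq191 (D.dev97 U p) (D.dev0 U p) D.α ((D.L ^ j)⁻¹) (D.ε j) (E124 D.ε D.L D.η D.k j))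
    (L80 : ∀ U, new189 D U → ∀ j, D.h ≤ j → j ≤ D.k → ∀ p ∈ plaqsOf (dom D j),
      B15.Ineq180 (D.dev0 U p) (D.ε D.k) D.η D.B₃ D.B₅ D.M D.δ (D.dist p) D.O1) :
    Claim189 (new189 D) (chiPP D) := by
  intro U hU
  -- elementary consequences of the numerics
  have hα0 : 0 ≤ D.α := by rw [hα]; norm_num
  have hα8 : D.α ≤ 1 / 8 := by rw [hα]; norm_num
  have hL1 : 1 ≤ D.L := by nlinarith
  have hL0 : 0 < D.L := by linarith
  have hLinv0 : ∀ n : ℕ, 0 ≤ (D.L ^ n)⁻¹ := fun n => by positivity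
  have hLinv1 : ∀ n : ℕ, (D.L ^ n)⁻¹ ≤ 1 := fun n => inv_le_one_of_one_le₀ (one_le_pow₀ hL1)
  have hhK : D.h ≤ D.k := by omega
  have hE : ∀ i, D.h ≤ i → i ≤ D.k → 0 ≤ E124 D.ε D.L D.η D.k i := fun i hi hik => by
    unfold E124; exact mul_nonneg (hε0 i hi hik) (sq_nonneg _)
  have he : 0 ≤ D.ε D.k * D.η ^ 2 := mul_nonneg (hε0 D.k hhK le_rfl) (sq_nonneg _)
  have hXexp : ∀ p : Plaq P 0, 0 ≤ D.O1 * D.B₃ * D.B₅ * D.M ^ 5 * Real.exp (-D.δ * D.dist p) := fun p =>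
    mul_nonneg hB (Real.exp_nonneg _)
  have hX0 : ∀ j, 0 ≤ X D j := fun j => by
    have : X D j = D.O1 * D.B₃ * D.B₅ * D.M ^ 5 * (1 + (D.L ^ j)⁻¹ * D.α * D.ε j) ^ 2 := by unfold X; ring
    rw [this]; exact mul_nonneg hB (sq_nonneg _)
  have hkh : D.k ≠ D.h := by omega
  have hδdist : ∀ p : Plaq P 0, 0 ≤ D.δ * D.dist p := fun p => mul_nonneg hδ (hdist p)
  -- the units `E_i` TRUNCATED to `0` off `[h, k]` (never read there): nonnegative at EVERY level, equal to `E_i` on `[h, k]`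
  obtain ⟨E', hE'eq, hE'0⟩ : ∃ E' : ℕ → ℝ, (∀ i, D.h ≤ i → i ≤ D.k → E' i = E124 D.ε D.L D.η D.k i) ∧ (∀ i, 0 ≤ E' i) :=
    ⟨fun i => if D.h ≤ i ∧ i ≤ D.k then E124 D.ε D.L D.η D.k i else 0, fun i hi hik => if_pos ⟨hi, hik⟩, fun i => by
      show 0 ≤ (if D.h ≤ i ∧ i ≤ D.k then E124 D.ε D.L D.η D.k i else 0)
      by_cases hc : D.h ≤ i ∧ i ≤ D.k
      · rw [if_pos hc]; exact hE i hc.1 hc.2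
      · rw [if_neg hc]⟩
  -- the (1.98) bound on the `j`-th ℍ-domain, `h ≦ j ≦ k`, from the three leaves (r12's `ineq198`)
  have h198 : ∀ j, D.h ≤ j → j ≤ D.k → ∀ p ∈ plaqsOf (dom D j),
      dist1 (plaqHol (D.Upp U) p) < (2 * (D.L ^ (D.k - j))⁻¹ + 4 * D.α
        + D.O1 * (1 + (D.L ^ j)⁻¹ * D.α * D.ε j) ^ 2 * D.B₃ * D.B₅ * D.M ^ 5 * Real.exp (-D.δ * D.dist p)
          * (D.L ^ (D.k - j))⁻¹) * E124 D.ε D.L D.η D.k j := by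
    intro j hj hjk p hp
    have hsc : D.ε D.k * D.η ^ 2 ≤ (D.L ^ (D.k - j))⁻¹ * E124 D.ε D.L D.η D.k j := by
      rcases Nat.lt_or_ge j D.k with hlt | hge
      · exact hscale j hj hlt
      · have hjk' : j = D.k := le_antisymm hjk hge
        subst hjk'
        simp [E124]
    exact ineq198 (L91 U hU j hj hjk p hp) (L97 U hU j hj hjk p hp) (L80 U hU j hj hjk p hp) hα0 hα8 (hLinv0 j)
      (hLinv1 j) (hε0 j hj hjk) (hε1 j hj hjk) (hE j hj hjk) (hXexp p) he hsc (hLinv1 _)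
  -- r12's p. 200 case analysis at the plaquette families of the four kinds of domains of (1.24) at n = N, in the truncated units
  obtain ⟨h1, h2, h3, h4, h5⟩ := lines124N_of_bounds (fun p => dist1 (plaqHol (D.Upp U) p)) hhk (by omega)
    E' (X D) X' (fun i => (1 / 2 : ℝ) ^ (D.k - i + 1)) D.dist hα8 hβ0 hβ hL₀ hL₀L hE'0 hX0 hX'
    (fun j => ⟨by positivity, pow_le_one₀ (by norm_num) (by norm_num)⟩) hδdist hsmall
    (fun m => plaqsOf (D.Ω m \ D.Ω (m + 1))) (plaqsOf ((D.Ω (D.k₀ + 1))ᶜ \ D.Zpp D.k)) (fun i => plaqsOf (dom D i))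
    (plaqsOf (half D))
    (by
      -- Ω_m∖Ω_{m+1}, k₀ < m < k: "We have j = k", last term ≦ α
      intro m hm hmk p hp
      have hp' : p ∈ plaqsOf (dom D D.k) := by
        rw [dom_k D hkh]; exact plaqsOf_mono (hjEqK m hm hmk) hp
      refine ⟨X D D.k * Real.exp (-D.δ * D.dist p), hlast m hm hmk p hp, ?_⟩
      have h := h198 D.k hhK le_rfl p hp'
      simp only [Nat.sub_self, pow_zero, inv_one] at h
      rw [hE'eq D.k hhK le_rfl]
      unfold X
      exact h)
    (by
      -- Ω^c_{k₀+1}∖Z″_k ⊆ Ω^c_k∖Z″_k (nested Ω's), j = k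
      intro p hp
      have hsub : (D.Ω (D.k₀ + 1))ᶜ \ D.Zpp D.k ⊆ domK D := fun x hx =>
        ⟨fun hxk => hx.1 (Ω_antitone hΩ (by omega : D.k₀ + 1 ≤ D.k) hxk), hx.2⟩
      have hp' : p ∈ plaqsOf (dom D D.k) := by
        rw [dom_k D hkh]; exact plaqsOf_mono hsub hp
      have h := h198 D.k hhK le_rfl p hp'
      rw [hE'eq D.k hhK le_rfl]
      unfold X
      exact h)
    (by
      -- the Z″-domains, h ≦ j < k
      intro j hj hjk' p hp
      have h := h198 j hj hjk'.le p hp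
      rw [hE'eq j hj hjk'.le]
      unfold X
      exact h)
    (by
      -- the half domain: (1.91), (1.95), χ_{h,1/2} ⇒ (1.96)₁
      intro p hp
      rw [hE'eq D.h le_rfl hhK]
      exact ineq196_first_of_191_195 (L91h U hU p hp) (L95 U hU p hp) (half_lt_of_new189 D hU hbox hp) hα
        (hLinv0 D.h) (hLinv1 D.h) (hε0 D.h le_rfl hhK) (hε1 D.h le_rfl hhK) (hE D.h le_rfl hhK))
  -- back to the units `E_i` on `[h, k]`, then the families cover the concrete regions of (1.24) at n = N
  refine chi124_top_of_lines D.Ω D.Zpp hk (D.Upp U) (fun m => plaqsOf (D.Ω m \ D.Ω (m + 1)))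
    (plaqsOf ((D.Ω (D.k₀ + 1))ᶜ \ D.Zpp D.k)) (fun i => plaqsOf (dom D i)) (plaqsOf (half D)) (fun m _ _ => subset_rfl) ?_
    subset_rfl ?_ ?_ ?_ ?_ ?_ ?_ ?_
  · -- the top region Ω_{k−1}∖Ω_{k+1} ⊆ Ω_{k−1}∖Ω_k (Ω_{k+1} := Ω_k)
    have hk1 : D.k - 1 + 1 = D.k := by omega
    show plaqsOf (D.Ω (D.k - 1) \ D.Ω (D.k + 1)) ⊆ plaqsOf (D.Ω (D.k - 1) \ D.Ω (D.k - 1 + 1))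
    rw [hk1]
    exact plaqsOf_mono fun x hx => ⟨hx.1, fun hxk => hx.2 (hΩtop hxk)⟩
  · -- Z″_{i+1}∖Z″_i, h < i < k
    intro i hi hik
    show plaqsOf (D.Zpp (i + 1) \ D.Zpp i) ⊆ plaqsOf (dom D i)
    rw [dom_j D (by omega) (by omega)]
    exact subset_rfl
  · -- Z″_{h+1}∩Ω_h ⊆ (Z″_{h+1}∩Ω_h∩Ω″^∼_{h+1}) ∪ ((Ω″^∼_{h+1})ᶜ∩Ω_h)
    show plaqsOf (D.Zpp (D.h + 1) ∩ D.Ω D.h) ⊆ plaqsOf (dom D D.h) ∪ plaqsOf (half D)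
    rw [dom_h]
    have hcover : D.Zpp (D.h + 1) ∩ D.Ω D.h ⊆ domH D ∪ half D := by
      intro x hx
      by_cases hxT : x ∈ D.OmT
      · exact Or.inl ⟨hx, hxT⟩
      · exact Or.inr ⟨hxT, hx.2⟩
    intro p hp
    rcases plaqsOf_mono hcover hp with h1 | h1 | h1 | h1 <;> rcases h1 with h | h
    · exact Or.inl (Or.inl h)
    · exact Or.inr (Or.inl h)
    · exact Or.inl (Or.inr (Or.inl h))
    · exact Or.inr (Or.inr (Or.inl h))
    · exact Or.inl (Or.inr (Or.inr (Or.inl h)))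
    · exact Or.inr (Or.inr (Or.inr (Or.inl h)))
    · exact Or.inl (Or.inr (Or.inr (Or.inr h)))
    · exact Or.inr (Or.inr (Or.inr (Or.inr h)))
  · intro hk2 p hp
    rw [← hE'eq D.k hhK le_rfl]
    exact h1 hk2 p hp
  · intro m hm hmk p hp
    rw [← hE'eq D.k hhK le_rfl]
    exact h2 m hm hmk p hp
  · intro p hp
    rw [← hE'eq D.k hhK le_rfl]
    exact h3 p hp
  · intro i hi hik p hp
    rw [← hE'eq i hi hik.le]
    exact h4 i hi hik p hp
  · intro p hp
    rw [← hE'eq D.h le_rfl hhK]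
    exact h5 p hp

/-- **(1.89), the proved part, with the two derived inputs traced to their printed sources — BOUNDED-LEVEL FORM** (p29's `claim189_assembly_of_flow` with
`hε0 ∕ hε1` on `h ≦ i ≦ k`): the units inequality from the [III] flow relation `hflow` (`hscale_of_flow_bdd`), p. 200's *"smaller than α"* from the shell
geometry and the choice of `M` (p29's `hlast_of_largeM`). [cite: Balaban1989LargeFieldI, (1.89) p.198, pp.199–200] -/
theorem claim189_assembly_of_flow_bdd (D : Setting189 P G C ι) (hhk : D.h ≤ D.k₀) (hk : D.k₀ + 2 ≤ D.k)
    (hΩ : ∀ i, D.Ω (i + 1) ⊆ D.Ω i) (hΩtop : D.Ω D.k ⊆ D.Ω (D.k + 1))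
    (hα : D.α = 1 / 12) (hβ0 : 0 ≤ D.β) (hβ : D.β ≤ 1 / 4) (hL₀ : 2 ≤ D.L₀) (hL₀L : D.L₀ ^ 2 ≤ D.L)
    (hε0 : ∀ i, D.h ≤ i → i ≤ D.k → 0 ≤ D.ε i) (hε1 : ∀ i, D.h ≤ i → i ≤ D.k → D.ε i ≤ 1 / 10)
    (hB : 0 ≤ D.O1 * D.B₃ * D.B₅ * D.M ^ 5) (hδ : 0 ≤ D.δ) (hM : 0 ≤ D.M) (hdist : ∀ p, 0 ≤ D.dist p)
    {X' : ℝ} (hX' : ∀ j, 2 + X D j ≤ X') (hsmall : X' * ((D.L₀ ^ 2) ^ (D.k - D.k₀ - 1))⁻¹ ≤ 1 / 4)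
    (hjEqK : ∀ m, D.k₀ < m → m < D.k → D.Ω m \ D.Ω (m + 1) ⊆ domK D)
    (hgeom : ∀ m, D.k₀ < m → m < D.k → ∀ p ∈ plaqsOf (D.Ω m \ D.Ω (m + 1)), 4 * ((m : ℝ) - D.k₀) * D.M ≤ D.dist p)
    (hlarge : X D D.k * Real.exp (-(4 * D.δ * D.M)) ≤ D.α)
    {β₀ : ℝ} (hβ₀0 : 0 ≤ β₀) (hβ₀ : β₀ ≤ 1 / 2)
    (hflow : ∀ j, D.h ≤ j → j < D.k → D.ε D.k ≤ (1 + β₀) * Real.sqrt ((D.k - j : ℕ) : ℝ) * D.ε j)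
    (hbox : ∀ p ∈ plaqsOf (half D), D.boxOf p ∈ D.halfcubes ∧ p ∈ D.plaqT (D.boxOf p))
    (L91h : ∀ U, new189 D U → ∀ p ∈ plaqsOf (half D),
      Ineq191 (dist1 (plaqHol (D.Upp U) p)) (D.devV'' U p) D.α ((D.L ^ D.h)⁻¹) (D.ε D.h) (E124 D.ε D.L D.η D.k D.h))
    (L95 : ∀ U, new189 D U → ∀ p ∈ plaqsOf (half D),
      Ineq195 (D.devV'' U p) (dist1 (plaqHol (D.Uhalf U (D.boxOf p)) p)) D.α ((D.L ^ D.h)⁻¹) (D.ε D.h)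
        (E124 D.ε D.L D.η D.k D.h))
    (L91 : ∀ U, new189 D U → ∀ j, D.h ≤ j → j ≤ D.k → ∀ p ∈ plaqsOf (dom D j),
      Ineq191 (dist1 (plaqHol (D.Upp U) p)) (D.dev97 U p) D.α ((D.L ^ j)⁻¹) (D.ε j) (E124 D.ε D.L D.η D.k j))
    (L97 : ∀ U, new189 D U → ∀ j, D.h ≤ j → j ≤ D.k → ∀ p ∈ plaqsOf (dom D j),
      Ineq191 (D.dev97 U p) (D.dev0 U p) D.α ((D.L ^ j)⁻¹) (D.ε j) (E124 D.ε D.L D.η D.k j))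
    (L80 : ∀ U, new189 D U → ∀ j, D.h ≤ j → j ≤ D.k → ∀ p ∈ plaqsOf (dom D j),
      B15.Ineq180 (D.dev0 U p) (D.ε D.k) D.η D.B₃ D.B₅ D.M D.δ (D.dist p) D.O1) :
    Claim189 (new189 D) (chiPP D) := by
  have hL2 : 2 ≤ D.L := by nlinarith
  have hX : 0 ≤ X D D.k := by
    have : X D D.k = D.O1 * D.B₃ * D.B₅ * D.M ^ 5 * (1 + (D.L ^ D.k)⁻¹ * D.α * D.ε D.k) ^ 2 := by unfold X; ring
    rw [this]; exact mul_nonneg hB (sq_nonneg _)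
  refine claim189_assembly_bdd D hhk hk hΩ hΩtop hα hβ0 hβ hL₀ hL₀L hε0 hε1 hB hδ hdist hX' hsmall hjEqK ?_
    (hscale_of_flow_bdd D hL2 hβ₀0 hβ₀ hε0 hflow) hbox L91h L95 L91 L97 L80
  intro m hm hmk p hp
  exact hlast_of_largeM D hδ hM hX hlarge hm (hgeom m hm hmk p hp) le_rfl

end BoundedAssembly

/-! ## §3. At NODE 00's record: `hflow`, `hε0`, `hε1` of the (1.89) display DISCHARGED from the run's window -/

section AtRecord

open DagBinding T4Continuum Node00
open B15 (Prop1Printed Ineq180)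
open B15.BasicStep (fibreIntegral Claim189)
open B15.PrelimIntegrations (Ineq191 Ineq195)
open B15Chi124DetSets (E124)
open B15Claim189Assembly (Setting189 new189 chiPP X dom domK half)
open B15Claim189PinAtRecord (D189OfRecord)
open B8Eq17ClassAkV1 (plaqsOf)
open GaugeGroup (dist1)
open GaugeField (plaqHol)
open B15RPrime1100OfRep (rPrimeDataOfSel)

variable {F : T4Family} {N : ℕ} [NeZero N] {θ : Stage9Params F N}

/-- **[III] (2.8), FIRST MEMBER, FOR THE THRESHOLDS OF RECORD ALONG THE RUN `P`**: the run's generated history `gOfRecord₁₀ θ P` in `]0, θ.γ]` up to level `n`,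
`betaOfRecord₁₀ θ ≦ β′` along that history, `SmallnessFor θ.γ β′ β₀ L θ.ν.p₀`, `0 ≦ A₀` ⇒ `ε_{n′} ≦ (1+β₀)(n′−m)^{1/2}ε_m`, `m < n′ ≦ n`.
[cite: Balaban1988Convergent, (2.8) p.256] -/
theorem epsOfRecord₁₀_flow28a (hA₀ : 0 ≤ θ.ν.A₀) {β' β₀ : ℝ} {L : ℕ} (S : SmallnessFor θ.γ β' β₀ L θ.ν.p₀) (P : B12.RunParams) {n : ℕ}
    (hI : Step.InInterval θ.γ n (gOfRecord₁₀ F N θ P))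
    (hub : ∀ j, j < n → betaOfRecord₁₀ F N θ j (prefixOf (gOfRecord₁₀ F N θ P) j) ≤ β') {m n' : ℕ} (hmn : m < n') (hn' : n' ≤ n) :
    epsOfRecord θ.ν (gOfRecord₁₀ F N θ P) n' ≤ (1 + β₀) * Real.sqrt ((n' : ℝ) - m) * epsOfRecord θ.ν (gOfRecord₁₀ F N θ P) m :=
  epsOfRecord_flow28a_of_inInterval θ.ν hA₀ S (betaOfRecord₁₀ F N θ) P.g0 hI hub hmn hn'

variable (P : B12.RunParams) (σ : Sit189 F N P.K)

/-- **MODULE 4's `hflow` DISCHARGED**: at the (1.89) letters of record `D189OfRecord θ P σ` (thresholds `ε_j = epsOfRecord θ.ν (gOfRecord₁₀ θ P) j`, levels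
`σ.h ≦ … ≦ σ.k`), the window up to `σ.k` + `β ≦ β′` along the history + `SmallnessFor` + `0 ≦ A₀` give `ε_k ≦ (1+β₀)(k−j)^{1/2}ε_j` for `h ≦ j < k`.
[cite: Balaban1988Convergent, (2.8) p.256; Balaban1989LargeFieldI, p.199] -/
theorem hflow_D189OfRecord_of_inInterval (hA₀ : 0 ≤ θ.ν.A₀) {β' β₀ : ℝ} {L : ℕ} (S : SmallnessFor θ.γ β' β₀ L θ.ν.p₀)
    (hI : Step.InInterval θ.γ σ.k (gOfRecord₁₀ F N θ P))
    (hub : ∀ j, j < σ.k → betaOfRecord₁₀ F N θ j (prefixOf (gOfRecord₁₀ F N θ P) j) ≤ β') :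
    ∀ j, (D189OfRecord θ P σ).h ≤ j → j < (D189OfRecord θ P σ).k →
      (D189OfRecord θ P σ).ε (D189OfRecord θ P σ).k
        ≤ (1 + β₀) * Real.sqrt (((D189OfRecord θ P σ).k - j : ℕ) : ℝ) * (D189OfRecord θ P σ).ε j := by
  intro j _ hjk
  show epsOfRecord θ.ν (gOfRecord₁₀ F N θ P) σ.k
    ≤ (1 + β₀) * Real.sqrt (((σ.k - j : ℕ) : ℝ)) * epsOfRecord θ.ν (gOfRecord₁₀ F N θ P) j
  have hjk' : j < σ.k := hjk
  rw [Nat.cast_sub hjk'.le]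
  exact epsOfRecord₁₀_flow28a hA₀ S P hI hub hjk' le_rfl

/-- **MODULE 4's `hε0` DISCHARGED on the levels of the situation**: `0 ≦ ε_i` for `h ≦ i ≦ k` from the window up to `σ.k` (`γ ≦ 1`, `0 ≦ A₀`).
[cite: Balaban1988Convergent, (2.4) p.255] -/
theorem eps_D189OfRecord_nonneg_of_inInterval (hA₀ : 0 ≤ θ.ν.A₀) (hγ1 : θ.γ ≤ 1) (hI : Step.InInterval θ.γ σ.k (gOfRecord₁₀ F N θ P)) :
    ∀ i, (D189OfRecord θ P σ).h ≤ i → i ≤ (D189OfRecord θ P σ).k → 0 ≤ (D189OfRecord θ P σ).ε i :=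
  fun _ _ hik => epsOfRecord_nonneg_of_inInterval θ.ν hA₀ hγ1 hI hik

/-- **MODULE 4's `hε1` DISCHARGED on the levels of the situation**: `ε_i ≦ 1/10` for `h ≦ i ≦ k` from the window up to `σ.k`, `SmallnessFor` and the numeric
clause `γA₀(log γ⁻²)^{p₀} ≦ 1/10`. [cite: Balaban1988Convergent, (2.4) p.255; Balaban1989LargeFieldI, p.199] -/
theorem eps_D189OfRecord_le_of_inInterval (hA₀ : 0 ≤ θ.ν.A₀) {β' β₀ : ℝ} {L : ℕ} (S : SmallnessFor θ.γ β' β₀ L θ.ν.p₀)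
    (hε10 : θ.γ * p0Profile θ.ν.A₀ θ.ν.p₀ θ.γ ≤ 1 / 10) (hI : Step.InInterval θ.γ σ.k (gOfRecord₁₀ F N θ P)) :
    ∀ i, (D189OfRecord θ P σ).h ≤ i → i ≤ (D189OfRecord θ P σ).k → (D189OfRecord θ P σ).ε i ≤ 1 / 10 :=
  fun _ _ hik => epsOfRecord_le_of_inInterval θ.ν hA₀ S hε10 hI hik

/-- **(1.89) AT THE PINNED LETTERS FROM THE LEAVES, THE GEOMETRY AND THE WINDOW**: `Claim189 (new189 D) (chiPP D)`, `D := D189OfRecord θ P σ`, by §2's bounded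
assembly with `hflow ∕ hε0 ∕ hε1` supplied by §3 — hypotheses: the window `Step.InInterval θ.γ σ.k (gOfRecord₁₀ θ P)`, `β ≦ β′` along the history, `SmallnessFor`,
`β₀ ≦ ½`, `0 ≦ A₀`, `γA₀(log γ⁻²)^{p₀} ≦ 1/10`; the situation's numerics ∕ nesting ∕ *"j = k"* ∕ shell geometry ∕ choice of `M` ∕ (1.88) cover; the leaves (1.90)–(1.91),
(1.93)–(1.95), p. 199's two (1.91)-type bounds and (1.80) at def-R's backgrounds of record. [cite: Balaban1989LargeFieldI, (1.89) p.198, pp.199–200; Balaban1988Convergent, (2.8) p.256] -/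
theorem claim189_D189OfRecord_of_inInterval
    (hhk : σ.h ≤ σ.k₀) (hk₀ : σ.k₀ + 2 ≤ σ.k)
    (hΩ : ∀ i, σ.Ω (i + 1) ⊆ σ.Ω i) (hΩtop : σ.Ω σ.k ⊆ σ.Ω (σ.k + 1))
    (hα : σ.α = 1 / 12) (hβ0 : 0 ≤ σ.β) (hβ : σ.β ≤ 1 / 4) (hL₀ : 2 ≤ σ.L₀) (hL₀L : σ.L₀ ^ 2 ≤ ((F.P P.K).L : ℝ))
    (hB : 0 ≤ σ.O1 * σ.B₃ * σ.B₅ * σ.M ^ 5) (hδ : 0 ≤ σ.δ) (hM : 0 ≤ σ.M) (hdist : ∀ p, 0 ≤ σ.dist p)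
    {X' : ℝ} (hX' : ∀ j, 2 + X (D189OfRecord θ P σ) j ≤ X') (hsmall : X' * ((σ.L₀ ^ 2) ^ (σ.k - σ.k₀ - 1))⁻¹ ≤ 1 / 4)
    (hjEqK : ∀ m, σ.k₀ < m → m < σ.k → σ.Ω m \ σ.Ω (m + 1) ⊆ domK (D189OfRecord θ P σ))
    (hgeom : ∀ m, σ.k₀ < m → m < σ.k → ∀ p ∈ plaqsOf (σ.Ω m \ σ.Ω (m + 1)), 4 * ((m : ℝ) - σ.k₀) * σ.M ≤ σ.dist p)
    (hlarge : X (D189OfRecord θ P σ) σ.k * Real.exp (-(4 * σ.δ * σ.M)) ≤ σ.α)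
    -- the window and the flow numerics (replace module 4's `hβ₀0 ∕ hβ₀ ∕ hflow ∕ hε0 ∕ hε1`)
    (hA₀ : 0 ≤ θ.ν.A₀) {β' β₀ : ℝ} {L : ℕ} (S : SmallnessFor θ.γ β' β₀ L θ.ν.p₀) (hβ₀ : β₀ ≤ 1 / 2)
    (hε10 : θ.γ * p0Profile θ.ν.A₀ θ.ν.p₀ θ.γ ≤ 1 / 10)
    (hI : Step.InInterval θ.γ σ.k (gOfRecord₁₀ F N θ P))
    (hub : ∀ j, j < σ.k → betaOfRecord₁₀ F N θ j (prefixOf (gOfRecord₁₀ F N θ P) j) ≤ β')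
    -- the (1.88) cover and the leaves, at def-R's backgrounds of record
    (hbox : ∀ p ∈ plaqsOf (half (D189OfRecord θ P σ)), σ.boxOf p ∈ (↑σ.Xhalf : Set _) ∧ p ∈ plaqInside (cubeEnl (F.P P.K) σ.sh (σ.boxOf p) 1))
    (L91h : ∀ U, new189 (D189OfRecord θ P σ) U → ∀ p ∈ plaqsOf (half (D189OfRecord θ P σ)),
      Ineq191 (dist1 (plaqHol ((D189OfRecord θ P σ).Upp U) p)) (σ.devV'' U.1 p) σ.α ((((F.P P.K).L : ℝ) ^ σ.h)⁻¹)
        (epsOfRecord θ.ν (gOfRecord₁₀ F N θ P) σ.h) (E124 (epsOfRecord θ.ν (gOfRecord₁₀ F N θ P)) ((F.P P.K).L : ℝ) ((F.P P.K).eta σ.k) σ.k σ.h))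
    (L95 : ∀ U, new189 (D189OfRecord θ P σ) U → ∀ p ∈ plaqsOf (half (D189OfRecord θ P σ)),
      Ineq195 (σ.devV'' U.1 p) (dist1 (plaqHol ((D189OfRecord θ P σ).Uhalf U (σ.boxOf p)) p)) σ.α ((((F.P P.K).L : ℝ) ^ σ.h)⁻¹)
        (epsOfRecord θ.ν (gOfRecord₁₀ F N θ P) σ.h) (E124 (epsOfRecord θ.ν (gOfRecord₁₀ F N θ P)) ((F.P P.K).L : ℝ) ((F.P P.K).eta σ.k) σ.k σ.h))
    (L91 : ∀ U, new189 (D189OfRecord θ P σ) U → ∀ j, σ.h ≤ j → j ≤ σ.k → ∀ p ∈ plaqsOf (dom (D189OfRecord θ P σ) j),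
      Ineq191 (dist1 (plaqHol ((D189OfRecord θ P σ).Upp U) p)) (σ.dev97 U.1 p) σ.α ((((F.P P.K).L : ℝ) ^ j)⁻¹)
        (epsOfRecord θ.ν (gOfRecord₁₀ F N θ P) j) (E124 (epsOfRecord θ.ν (gOfRecord₁₀ F N θ P)) ((F.P P.K).L : ℝ) ((F.P P.K).eta σ.k) σ.k j))
    (L97 : ∀ U, new189 (D189OfRecord θ P σ) U → ∀ j, σ.h ≤ j → j ≤ σ.k → ∀ p ∈ plaqsOf (dom (D189OfRecord θ P σ) j),
      Ineq191 (σ.dev97 U.1 p) (σ.dev0 U.1 p) σ.α ((((F.P P.K).L : ℝ) ^ j)⁻¹) (epsOfRecord θ.ν (gOfRecord₁₀ F N θ P) j)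
        (E124 (epsOfRecord θ.ν (gOfRecord₁₀ F N θ P)) ((F.P P.K).L : ℝ) ((F.P P.K).eta σ.k) σ.k j))
    (L80 : ∀ U, new189 (D189OfRecord θ P σ) U → ∀ i, σ.h ≤ i → i ≤ σ.k → ∀ q ∈ plaqsOf (dom (D189OfRecord θ P σ) i),
      Ineq180 (σ.dev0 U.1 q) (epsOfRecord θ.ν (gOfRecord₁₀ F N θ P) σ.k) ((F.P P.K).eta σ.k) σ.B₃ σ.B₅ σ.M σ.δ (σ.dist q) σ.O1) :
    Claim189 (new189 (D189OfRecord θ P σ)) (chiPP (D189OfRecord θ P σ)) :=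
  claim189_assembly_of_flow_bdd (D189OfRecord θ P σ) hhk hk₀ hΩ hΩtop hα hβ0 hβ hL₀ hL₀L
    (eps_D189OfRecord_nonneg_of_inInterval P σ hA₀ S.γ_lt_one.le hI) (eps_D189OfRecord_le_of_inInterval P σ hA₀ S hε10 hI)
    hB hδ hM hdist hX' hsmall hjEqK hgeom hlarge S.β₀_pos.le hβ₀ (hflow_D189OfRecord_of_inInterval P σ hA₀ S hI hub) hbox L91h L95 L91 L97 L80

variable {P} {lam : ResidW F N}

/-- **THE [IV] DISPLAYS AT A LAYER WITH PINNED (1.89) LETTERS AND PINNED (1.100) DATA, THE FLOW INPUTS OF (1.89) READ OFF THE WINDOW** — module 4's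
`wDisplays₁₀_pinD189_of_rPrimePin_leaves` with its hypotheses `hβ₀0 ∕ hβ₀ ∕ hflow ∕ hε0 ∕ hε1` REPLACED by: the run's window `Step.InInterval θ.γ (σ P).k (gOfRecord₁₀ θ P)`,
`betaOfRecord₁₀ θ ≦ β′` along the run's history, `SmallnessFor θ.γ β′ β₀ L θ.ν.p₀` with `β₀ ≦ ½`, `0 ≦ A₀`, `γA₀(log γ⁻²)^{p₀} ≦ 1/10`.  What stays displayed:
`Provisos₁₀`, `kSel P < P.K`, the (1.100) pin equation, positive mass, Proposition 1 (1.78), (1.80) at the letter `σ.dev0`, the situation's numerics ∕ geometry,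
and the leaves (1.90)–(1.97) at def-R's backgrounds of record. [cite: Balaban1989LargeFieldI, (1.89) p.198, pp.199–200, (1.80) p.195, Prop. 1 (1.78) p.194, (0.2)–(0.4) p.176, (1.99)–(1.102) pp.200–201; Balaban1988Convergent, (2.8) p.256] -/
theorem wDisplays₁₀_pinD189_of_rPrimePin_leaves_inInterval (hP : θ.Provisos₁₀) (σ : ∀ P : B12.RunParams, Sit189 F N P.K) {P : B12.RunParams}
    (hk : lam.kSel P < P.K)
    (hpin : lam.D1100 P
      = rPrimeDataOfSel (repTOfRecord9 F N θ.ν θ.τ9 (EOfRecord₁₀ F N θ) (wOfRecord₉ F N θ) θ.ppSel P (gOfRecord₁₀ F N θ P) (lam.kSel P))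
          (θ.ppSel P (gOfRecord₁₀ F N θ P) (lam.kSel P + 1)) (fibOfSeq F θ.ν θ.τ9 P (gOfRecord₁₀ F N θ P) (lam.kSel P + 1)))
    (hmass : ∀ s, 0 < ∫ V, rterm (repTOfRecord9 F N θ.ν θ.τ9 (EOfRecord₁₀ F N θ) (wOfRecord₉ F N θ) θ.ppSel P (gOfRecord₁₀ F N θ P) (lam.kSel P)) s V
      ∂(fieldMeasure (F.P P.K) (lam.kSel P + 1) (SU N)))
    (hP1 : Prop1Printed (lam.LF P))
    (h180 : ∀ U, new189 (D189OfRecord θ P (σ P)) U → ∀ i, (σ P).h ≤ i → i ≤ (σ P).k → ∀ q ∈ plaqsOf (dom (D189OfRecord θ P (σ P)) i),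
      Ineq180 ((σ P).dev0 U.1 q) (epsOfRecord θ.ν (gOfRecord₁₀ F N θ P) (σ P).k) ((F.P P.K).eta (σ P).k) (σ P).B₃ (σ P).B₅ (σ P).M (σ P).δ ((σ P).dist q) (σ P).O1)
    (hhk : (σ P).h ≤ (σ P).k₀) (hk₀ : (σ P).k₀ + 2 ≤ (σ P).k)
    (hΩ : ∀ i, (σ P).Ω (i + 1) ⊆ (σ P).Ω i) (hΩtop : (σ P).Ω (σ P).k ⊆ (σ P).Ω ((σ P).k + 1))
    (hα : (σ P).α = 1 / 12) (hβ0 : 0 ≤ (σ P).β) (hβ : (σ P).β ≤ 1 / 4) (hL₀ : 2 ≤ (σ P).L₀) (hL₀L : (σ P).L₀ ^ 2 ≤ ((F.P P.K).L : ℝ))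
    (hB : 0 ≤ (σ P).O1 * (σ P).B₃ * (σ P).B₅ * (σ P).M ^ 5) (hδ : 0 ≤ (σ P).δ) (hM : 0 ≤ (σ P).M) (hdist : ∀ p, 0 ≤ (σ P).dist p)
    {X' : ℝ} (hX' : ∀ j, 2 + X (D189OfRecord θ P (σ P)) j ≤ X') (hsmall : X' * (((σ P).L₀ ^ 2) ^ ((σ P).k - (σ P).k₀ - 1))⁻¹ ≤ 1 / 4)
    (hjEqK : ∀ m, (σ P).k₀ < m → m < (σ P).k → (σ P).Ω m \ (σ P).Ω (m + 1) ⊆ domK (D189OfRecord θ P (σ P)))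
    (hgeom : ∀ m, (σ P).k₀ < m → m < (σ P).k → ∀ p ∈ plaqsOf ((σ P).Ω m \ (σ P).Ω (m + 1)), 4 * ((m : ℝ) - (σ P).k₀) * (σ P).M ≤ (σ P).dist p)
    (hlarge : X (D189OfRecord θ P (σ P)) (σ P).k * Real.exp (-(4 * (σ P).δ * (σ P).M)) ≤ (σ P).α)
    -- the window and the flow numerics
    (hA₀ : 0 ≤ θ.ν.A₀) {β' β₀ : ℝ} {L : ℕ} (S : SmallnessFor θ.γ β' β₀ L θ.ν.p₀) (hβ₀ : β₀ ≤ 1 / 2)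
    (hε10 : θ.γ * p0Profile θ.ν.A₀ θ.ν.p₀ θ.γ ≤ 1 / 10)
    (hI : Step.InInterval θ.γ (σ P).k (gOfRecord₁₀ F N θ P))
    (hub : ∀ j, j < (σ P).k → betaOfRecord₁₀ F N θ j (prefixOf (gOfRecord₁₀ F N θ P) j) ≤ β')
    -- the (1.88) cover and the leaves
    (hbox : ∀ p ∈ plaqsOf (half (D189OfRecord θ P (σ P))), (σ P).boxOf p ∈ (↑(σ P).Xhalf : Set _) ∧ p ∈ plaqInside (cubeEnl (F.P P.K) (σ P).sh ((σ P).boxOf p) 1))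
    (L91h : ∀ U, new189 (D189OfRecord θ P (σ P)) U → ∀ p ∈ plaqsOf (half (D189OfRecord θ P (σ P))),
      Ineq191 (dist1 (plaqHol ((D189OfRecord θ P (σ P)).Upp U) p)) ((σ P).devV'' U.1 p) (σ P).α ((((F.P P.K).L : ℝ) ^ (σ P).h)⁻¹)
        (epsOfRecord θ.ν (gOfRecord₁₀ F N θ P) (σ P).h) (E124 (epsOfRecord θ.ν (gOfRecord₁₀ F N θ P)) ((F.P P.K).L : ℝ) ((F.P P.K).eta (σ P).k) (σ P).k (σ P).h))
    (L95 : ∀ U, new189 (D189OfRecord θ P (σ P)) U → ∀ p ∈ plaqsOf (half (D189OfRecord θ P (σ P))),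
      Ineq195 ((σ P).devV'' U.1 p) (dist1 (plaqHol ((D189OfRecord θ P (σ P)).Uhalf U ((σ P).boxOf p)) p)) (σ P).α ((((F.P P.K).L : ℝ) ^ (σ P).h)⁻¹)
        (epsOfRecord θ.ν (gOfRecord₁₀ F N θ P) (σ P).h) (E124 (epsOfRecord θ.ν (gOfRecord₁₀ F N θ P)) ((F.P P.K).L : ℝ) ((F.P P.K).eta (σ P).k) (σ P).k (σ P).h))
    (L91 : ∀ U, new189 (D189OfRecord θ P (σ P)) U → ∀ j, (σ P).h ≤ j → j ≤ (σ P).k → ∀ p ∈ plaqsOf (dom (D189OfRecord θ P (σ P)) j),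
      Ineq191 (dist1 (plaqHol ((D189OfRecord θ P (σ P)).Upp U) p)) ((σ P).dev97 U.1 p) (σ P).α ((((F.P P.K).L : ℝ) ^ j)⁻¹)
        (epsOfRecord θ.ν (gOfRecord₁₀ F N θ P) j) (E124 (epsOfRecord θ.ν (gOfRecord₁₀ F N θ P)) ((F.P P.K).L : ℝ) ((F.P P.K).eta (σ P).k) (σ P).k j))
    (L97 : ∀ U, new189 (D189OfRecord θ P (σ P)) U → ∀ j, (σ P).h ≤ j → j ≤ (σ P).k → ∀ p ∈ plaqsOf (dom (D189OfRecord θ P (σ P)) j),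
      Ineq191 ((σ P).dev97 U.1 p) ((σ P).dev0 U.1 p) (σ P).α ((((F.P P.K).L : ℝ) ^ j)⁻¹) (epsOfRecord θ.ν (gOfRecord₁₀ F N θ P) j)
        (E124 (epsOfRecord θ.ν (gOfRecord₁₀ F N θ P)) ((F.P P.K).L : ℝ) ((F.P P.K).eta (σ P).k) (σ P).k j)) :
    WDisplays₁₀ θ (lam.pinD189 θ σ) P :=
  B15RPrime1100AtRecord.wDisplays₁₀_of_rPrimePin (lam := lam.pinD189 θ σ) hP hk hpin hmass hP1 h180
    (claim189_D189OfRecord_of_inInterval P (σ P) hhk hk₀ hΩ hΩtop hα hβ0 hβ hL₀ hL₀L hB hδ hM hdist hX' hsmall hjEqK hgeom hlarge hA₀ S hβ₀ hε10 hI hub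
      hbox L91h L95 L91 L97 h180)

/-- **The same from the BOX bound on the β-functions of record** (`FlowStep.BetaUpperH β′ θ.γ (betaOfRecord₁₀ θ)`, [I] p. 264 — the binder N24's glue carries as
`βfun ≦ βup` on `]0, γ₀]^{k+1}`): `hub` along the run's history follows (`betaAlongHistory_le_of_betaUpperH`). [cite: Balaban1987RG1, §1 p.264; Balaban1989LargeFieldI, (1.89) p.198, pp.199–200] -/
theorem claim189_D189OfRecord_of_betaUpperH
    (hhk : σ.h ≤ σ.k₀) (hk₀ : σ.k₀ + 2 ≤ σ.k)
    (hΩ : ∀ i, σ.Ω (i + 1) ⊆ σ.Ω i) (hΩtop : σ.Ω σ.k ⊆ σ.Ω (σ.k + 1))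
    (hα : σ.α = 1 / 12) (hβ0 : 0 ≤ σ.β) (hβ : σ.β ≤ 1 / 4) (hL₀ : 2 ≤ σ.L₀) (hL₀L : σ.L₀ ^ 2 ≤ ((F.P P.K).L : ℝ))
    (hB : 0 ≤ σ.O1 * σ.B₃ * σ.B₅ * σ.M ^ 5) (hδ : 0 ≤ σ.δ) (hM : 0 ≤ σ.M) (hdist : ∀ p, 0 ≤ σ.dist p)
    {X' : ℝ} (hX' : ∀ j, 2 + X (D189OfRecord θ P σ) j ≤ X') (hsmall : X' * ((σ.L₀ ^ 2) ^ (σ.k - σ.k₀ - 1))⁻¹ ≤ 1 / 4)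
    (hjEqK : ∀ m, σ.k₀ < m → m < σ.k → σ.Ω m \ σ.Ω (m + 1) ⊆ domK (D189OfRecord θ P σ))
    (hgeom : ∀ m, σ.k₀ < m → m < σ.k → ∀ p ∈ plaqsOf (σ.Ω m \ σ.Ω (m + 1)), 4 * ((m : ℝ) - σ.k₀) * σ.M ≤ σ.dist p)
    (hlarge : X (D189OfRecord θ P σ) σ.k * Real.exp (-(4 * σ.δ * σ.M)) ≤ σ.α)
    (hA₀ : 0 ≤ θ.ν.A₀) {β' β₀ : ℝ} {L : ℕ} (S : SmallnessFor θ.γ β' β₀ L θ.ν.p₀) (hβ₀ : β₀ ≤ 1 / 2)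
    (hε10 : θ.γ * p0Profile θ.ν.A₀ θ.ν.p₀ θ.γ ≤ 1 / 10)
    (hI : Step.InInterval θ.γ σ.k (gOfRecord₁₀ F N θ P)) (hup : BetaUpperH β' θ.γ (betaOfRecord₁₀ F N θ))
    (hbox : ∀ p ∈ plaqsOf (half (D189OfRecord θ P σ)), σ.boxOf p ∈ (↑σ.Xhalf : Set _) ∧ p ∈ plaqInside (cubeEnl (F.P P.K) σ.sh (σ.boxOf p) 1))
    (L91h : ∀ U, new189 (D189OfRecord θ P σ) U → ∀ p ∈ plaqsOf (half (D189OfRecord θ P σ)),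
      Ineq191 (dist1 (plaqHol ((D189OfRecord θ P σ).Upp U) p)) (σ.devV'' U.1 p) σ.α ((((F.P P.K).L : ℝ) ^ σ.h)⁻¹)
        (epsOfRecord θ.ν (gOfRecord₁₀ F N θ P) σ.h) (E124 (epsOfRecord θ.ν (gOfRecord₁₀ F N θ P)) ((F.P P.K).L : ℝ) ((F.P P.K).eta σ.k) σ.k σ.h))
    (L95 : ∀ U, new189 (D189OfRecord θ P σ) U → ∀ p ∈ plaqsOf (half (D189OfRecord θ P σ)),
      Ineq195 (σ.devV'' U.1 p) (dist1 (plaqHol ((D189OfRecord θ P σ).Uhalf U (σ.boxOf p)) p)) σ.α ((((F.P P.K).L : ℝ) ^ σ.h)⁻¹)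
        (epsOfRecord θ.ν (gOfRecord₁₀ F N θ P) σ.h) (E124 (epsOfRecord θ.ν (gOfRecord₁₀ F N θ P)) ((F.P P.K).L : ℝ) ((F.P P.K).eta σ.k) σ.k σ.h))
    (L91 : ∀ U, new189 (D189OfRecord θ P σ) U → ∀ j, σ.h ≤ j → j ≤ σ.k → ∀ p ∈ plaqsOf (dom (D189OfRecord θ P σ) j),
      Ineq191 (dist1 (plaqHol ((D189OfRecord θ P σ).Upp U) p)) (σ.dev97 U.1 p) σ.α ((((F.P P.K).L : ℝ) ^ j)⁻¹)
        (epsOfRecord θ.ν (gOfRecord₁₀ F N θ P) j) (E124 (epsOfRecord θ.ν (gOfRecord₁₀ F N θ P)) ((F.P P.K).L : ℝ) ((F.P P.K).eta σ.k) σ.k j))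
    (L97 : ∀ U, new189 (D189OfRecord θ P σ) U → ∀ j, σ.h ≤ j → j ≤ σ.k → ∀ p ∈ plaqsOf (dom (D189OfRecord θ P σ) j),
      Ineq191 (σ.dev97 U.1 p) (σ.dev0 U.1 p) σ.α ((((F.P P.K).L : ℝ) ^ j)⁻¹) (epsOfRecord θ.ν (gOfRecord₁₀ F N θ P) j)
        (E124 (epsOfRecord θ.ν (gOfRecord₁₀ F N θ P)) ((F.P P.K).L : ℝ) ((F.P P.K).eta σ.k) σ.k j))
    (L80 : ∀ U, new189 (D189OfRecord θ P σ) U → ∀ i, σ.h ≤ i → i ≤ σ.k → ∀ q ∈ plaqsOf (dom (D189OfRecord θ P σ) i),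
      Ineq180 (σ.dev0 U.1 q) (epsOfRecord θ.ν (gOfRecord₁₀ F N θ P) σ.k) ((F.P P.K).eta σ.k) σ.B₃ σ.B₅ σ.M σ.δ (σ.dist q) σ.O1) :
    Claim189 (new189 (D189OfRecord θ P σ)) (chiPP (D189OfRecord θ P σ)) :=
  claim189_D189OfRecord_of_inInterval P σ hhk hk₀ hΩ hΩtop hα hβ0 hβ hL₀ hL₀L hB hδ hM hdist hX' hsmall hjEqK hgeom hlarge hA₀ S hβ₀ hε10 hI
    (betaAlongHistory_le_of_betaUpperH hup hI) hbox L91h L95 L91 L97 L80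

end AtRecord

/-! ## §4. The window and the β′ bound ARE LEAVES OF THE SAME RUN at a world bound to the record's construction -/

section Leaves

open DagBinding T4Continuum Node00

variable {F : T4Family} {N : ℕ} [NeZero N] {θ : Stage9Params F N} {w : WorldP} {P : B12.RunParams}

/-- **THE WINDOW IS THE RUN'S `smallCouplings` LEAF**: at a world whose construction carries the record's generated flow at the run `P` (`(w.C P).flow = genFlow β₁₀ g₀`,
`rfl` at `datumOfRecord₁₀` by `Node00.flow_datumOfRecord₁₀`; the ₁₁ ∕ ₁₂ data read the Stage-9 view) with window constant `w.γ ≦ θ.γ` (a clause of every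
`IsRecordOfRecord…`), the leaf `(leavesP w P).smallCouplings` (`g_k ∈ ]0, w.γ]`, `k ≦ K`) gives `Step.InInterval θ.γ n (gOfRecord₁₀ θ P)` for every `n ≦ P.K`.
[cite: Balaban1987RG1, Thm 1 p.256 (the standing hypothesis `0 < g_k ≦ γ`); Balaban1989LargeFieldII, Thm 1 p.355] -/
theorem inInterval_gOfRecord₁₀_of_smallCouplings (hfl : (w.C P).flow = genFlow (betaOfRecord₁₀ F N θ) P.g0) (hγ : w.γ ≤ θ.γ)
    (hsc : (leavesP w P).smallCouplings) {n : ℕ} (hn : n ≤ P.K) : Step.InInterval θ.γ n (gOfRecord₁₀ F N θ P) := by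
  have hsc' : (w.C P).flow.InInterval w.γ P.K := hsc
  rw [hfl] at hsc'
  intro k hk
  obtain ⟨h0, h1⟩ := hsc' k (hk.trans hn)
  exact ⟨h0, h1.trans hγ⟩

/-- **THE β′ BOUND ALONG THE HISTORY IS THE RUN'S `betaSmoothBounded` LEAF** (`β_{j+1}(g_j) ≦ βup`, `j < K`, [I] p. 264): at such a world it reads
`betaOfRecord₁₀ θ j (g_0,…,g_j) ≦ w.βup` for `j < n ≦ P.K` (§1's `beta_genFlow_succ_apply`). [cite: Balaban1987RG1, §1 p.264] -/
theorem betaAlongHistory_le_of_betaSmoothBounded (hfl : (w.C P).flow = genFlow (betaOfRecord₁₀ F N θ) P.g0)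
    (hβ : (leavesP w P).betaSmoothBounded) {n : ℕ} (hn : n ≤ P.K) :
    ∀ j, j < n → betaOfRecord₁₀ F N θ j (prefixOf (gOfRecord₁₀ F N θ P) j) ≤ w.βup := by
  have hβ' : ∀ j, j < P.K → (w.C P).flow.β (j + 1) ((w.C P).flow.g j) ≤ w.βup := hβ
  rw [hfl] at hβ'
  intro j hj
  rw [← beta_genFlow_succ_apply (betaOfRecord₁₀ F N θ) P.g0 j]
  exact hβ' j (lt_of_lt_of_le hj hn)

/-- **Hence module 4's `hflow` at the (1.89) letters of record FROM THE TWO LEAVES of the run** (situation step `σ.k ≦ P.K`; `SmallnessFor θ.γ w.βup β₀ L p₀`,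
`0 ≦ A₀`). [cite: Balaban1988Convergent, (2.8) p.256; Balaban1989LargeFieldI, p.199] -/
theorem hflow_D189OfRecord_of_leaves (hfl : (w.C P).flow = genFlow (betaOfRecord₁₀ F N θ) P.g0) (hγ : w.γ ≤ θ.γ)
    (hsc : (leavesP w P).smallCouplings) (hβ : (leavesP w P).betaSmoothBounded) (σ : Sit189 F N P.K) (hkK : σ.k ≤ P.K)
    (hA₀ : 0 ≤ θ.ν.A₀) {β₀ : ℝ} {L : ℕ} (S : SmallnessFor θ.γ w.βup β₀ L θ.ν.p₀) :
    ∀ j, (B15Claim189PinAtRecord.D189OfRecord θ P σ).h ≤ j → j < (B15Claim189PinAtRecord.D189OfRecord θ P σ).k →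
      (B15Claim189PinAtRecord.D189OfRecord θ P σ).ε (B15Claim189PinAtRecord.D189OfRecord θ P σ).k
        ≤ (1 + β₀) * Real.sqrt (((B15Claim189PinAtRecord.D189OfRecord θ P σ).k - j : ℕ) : ℝ) * (B15Claim189PinAtRecord.D189OfRecord θ P σ).ε j :=
  hflow_D189OfRecord_of_inInterval P σ hA₀ S (inInterval_gOfRecord₁₀_of_smallCouplings hfl hγ hsc hkK)
    (betaAlongHistory_le_of_betaSmoothBounded hfl hβ hkK)

/-- **A2 — the flow hypothesis of §4 holds BY `rfl` at the Stage-10 datum of record**: `((datumOfRecord₁₀ θ h).C P).flow = genFlow (betaOfRecord₁₀ θ) P.g₀`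
(def-T's `flow_datumOfRecord₁₀`), so at every world with `w.C = (datumOfRecord₁₀ θ h).C` the two leaves above feed §3. [cite: Balaban1987RG1, (0.17)–(0.20) pp.255–256 (bookkeeping)] -/
theorem flow_eq_genFlow_of_C_eq {h : θ.Provisos₁₀} (hC : w.C = (datumOfRecord₁₀ F N θ h).C) (P : B12.RunParams) :
    (w.C P).flow = genFlow (betaOfRecord₁₀ F N θ) P.g0 := by
  rw [hC]
  exact flow_datumOfRecord₁₀ F N θ h P

end Leaves

/-! ## §5. (v1.1) At ADMISSIBLE parameters: `0 < A₀` is a clause of `Stage7Params.Admissible`, so the sign inputs need no separate hypothesis -/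

section Admissible

open DagBinding T4Continuum Node00

variable {F : T4Family} {N : ℕ} [NeZero N] {θ : Stage9Params F N}

/-- `0 < A₀` IS A CLAUSE OF ADMISSIBILITY (def-R's PLUG-RECIPE-7 numeric window `Stage7Params.Admissible`, carried by Stage 8 and Stage 9).
[cite: Balaban1988Convergent, (2.4) p.255 (hypothesis dictionary)] -/
theorem A₀_pos_of_admissible (hθ : θ.Admissible) : 0 < θ.ν.A₀ := hθ.1.1.2.2.2.1

/-- **THE THRESHOLDS OF RECORD ARE POSITIVE IN THE WINDOW at admissible parameters with `γ < 1`**: `0 < ε_j` for `j ≦ n` along the run's history — the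
shape of def-T's displayed `hε : ∀ j ≤ n, 0 < epsOfRecord θ.ν (gOfRecord₁₀ …) j` slots (`Node00.Record12`), read off the run's window.
[cite: Balaban1988Convergent, (2.4) p.255; Balaban1987RG1, Thm 1 p.256 (the standing hypothesis `0 < g_k ≦ γ`)] -/
theorem epsOfRecord₁₀_pos_of_admissible (hθ : θ.Admissible) (hγ1 : θ.γ < 1) (P : B12.RunParams) {n : ℕ}
    (hI : Step.InInterval θ.γ n (gOfRecord₁₀ F N θ P)) : ∀ j, j ≤ n → 0 < epsOfRecord θ.ν (gOfRecord₁₀ F N θ P) j :=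
  fun _ hj => epsOfRecord_pos_of_inInterval θ.ν (A₀_pos_of_admissible hθ) hγ1 hI hj

/-- … and nonnegative (`γ ≦ 1`). [cite: Balaban1988Convergent, (2.4) p.255] -/
theorem epsOfRecord₁₀_nonneg_of_admissible (hθ : θ.Admissible) (hγ1 : θ.γ ≤ 1) (P : B12.RunParams) {n : ℕ}
    (hI : Step.InInterval θ.γ n (gOfRecord₁₀ F N θ P)) : ∀ j, j ≤ n → 0 ≤ epsOfRecord θ.ν (gOfRecord₁₀ F N θ P) j :=
  fun _ hj => epsOfRecord_nonneg_of_inInterval θ.ν (A₀_pos_of_admissible hθ).le hγ1 hI hj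

/-- **Module 4's `hflow` at admissible parameters** (the `0 ≦ A₀` input of `hflow_D189OfRecord_of_inInterval` read off admissibility).
[cite: Balaban1988Convergent, (2.8) p.256; Balaban1989LargeFieldI, p.199] -/
theorem hflow_D189OfRecord_of_admissible (hθ : θ.Admissible) {β' β₀ : ℝ} {L : ℕ} (S : SmallnessFor θ.γ β' β₀ L θ.ν.p₀) (P : B12.RunParams)
    (σ : Sit189 F N P.K) (hI : Step.InInterval θ.γ σ.k (gOfRecord₁₀ F N θ P))
    (hub : ∀ j, j < σ.k → betaOfRecord₁₀ F N θ j (prefixOf (gOfRecord₁₀ F N θ P) j) ≤ β') :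
    ∀ j, (B15Claim189PinAtRecord.D189OfRecord θ P σ).h ≤ j → j < (B15Claim189PinAtRecord.D189OfRecord θ P σ).k →
      (B15Claim189PinAtRecord.D189OfRecord θ P σ).ε (B15Claim189PinAtRecord.D189OfRecord θ P σ).k
        ≤ (1 + β₀) * Real.sqrt (((B15Claim189PinAtRecord.D189OfRecord θ P σ).k - j : ℕ) : ℝ) * (B15Claim189PinAtRecord.D189OfRecord θ P σ).ε j :=
  hflow_D189OfRecord_of_inInterval P σ (A₀_pos_of_admissible hθ).le S hI hub

/-- **Module 4's `hflow` at a world with the record's flow and admissible parameters, FROM THE TWO LEAVES** (`smallCouplings`, `betaSmoothBounded`).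
[cite: Balaban1988Convergent, (2.8) p.256; Balaban1987RG1, §1 p.264] -/
theorem hflow_D189OfRecord_of_leaves_of_admissible {w : WorldP} {P : B12.RunParams} (hθ : θ.Admissible)
    (hfl : (w.C P).flow = genFlow (betaOfRecord₁₀ F N θ) P.g0) (hγ : w.γ ≤ θ.γ)
    (hsc : (leavesP w P).smallCouplings) (hβ : (leavesP w P).betaSmoothBounded) (σ : Sit189 F N P.K) (hkK : σ.k ≤ P.K)
    {β₀ : ℝ} {L : ℕ} (S : SmallnessFor θ.γ w.βup β₀ L θ.ν.p₀) :
    ∀ j, (B15Claim189PinAtRecord.D189OfRecord θ P σ).h ≤ j → j < (B15Claim189PinAtRecord.D189OfRecord θ P σ).k →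
      (B15Claim189PinAtRecord.D189OfRecord θ P σ).ε (B15Claim189PinAtRecord.D189OfRecord θ P σ).k
        ≤ (1 + β₀) * Real.sqrt (((B15Claim189PinAtRecord.D189OfRecord θ P σ).k - j : ℕ) : ℝ) * (B15Claim189PinAtRecord.D189OfRecord θ P σ).ε j :=
  hflow_D189OfRecord_of_leaves hfl hγ hsc hβ σ hkK (A₀_pos_of_admissible hθ).le S

end Admissible

/-! ## §6. (v1.2) (1.89) at the pinned letters FROM THE RUN'S TWO LEAVES — the consumer shape of LOCATED (L1) (a `B15_main` ∕ W-leaf re-cut that hands the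
[IV] leaf the run's `smallCouplings` and `betaSmoothBounded`) -/

section FromLeaves

open DagBinding T4Continuum Node00
open B15 (Ineq180)
open B15.BasicStep (Claim189)
open B15.PrelimIntegrations (Ineq191 Ineq195)
open B15Chi124DetSets (E124)
open B15Claim189Assembly (new189 chiPP X dom domK half)
open B15Claim189PinAtRecord (D189OfRecord)
open B8Eq17ClassAkV1 (plaqsOf)
open GaugeGroup (dist1)
open GaugeField (plaqHol)

variable {F : T4Family} {N : ℕ} [NeZero N] {θ : Stage9Params F N} {w : WorldP} {P : B12.RunParams}

/-- **(1.89) AT THE PINNED LETTERS OF RECORD FROM THE LEAVES `smallCouplings` AND `betaSmoothBounded` OF THE SAME RUN** (at a world carrying the record's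
generated flow, `w.γ ≦ θ.γ`, admissible `θ`, situation step `σ.k ≦ P.K`): §3's `claim189_D189OfRecord_of_inInterval` with the window and the β′ bound SUPPLIED BY THE
TWO LEAVES (§4) and `0 ≦ A₀` by admissibility (§5).  This is the exact shape a re-cut `Dag.B15_main` (with `ℓ.smallCouplings → ℓ.betaSmoothBounded → …` among its
antecedents) or a window-guarded W-leaf would consume; the situation's numerics ∕ geometry, the (1.88) cover and the leaves (1.90)–(1.97), (1.80) stay displayed.
[cite: Balaban1989LargeFieldI, (1.89) p.198, pp.199–200; Balaban1988Convergent, (2.8) p.256; Balaban1987RG1, Thm 1 p.256, §1 p.264] -/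
theorem claim189_D189OfRecord_of_leaves (hθ : θ.Admissible) (hfl : (w.C P).flow = genFlow (betaOfRecord₁₀ F N θ) P.g0) (hγ : w.γ ≤ θ.γ)
    (hsc : (leavesP w P).smallCouplings) (hβs : (leavesP w P).betaSmoothBounded) (σ : Sit189 F N P.K) (hkK : σ.k ≤ P.K)
    {β₀ : ℝ} {L : ℕ} (S : SmallnessFor θ.γ w.βup β₀ L θ.ν.p₀) (hβ₀ : β₀ ≤ 1 / 2) (hε10 : θ.γ * p0Profile θ.ν.A₀ θ.ν.p₀ θ.γ ≤ 1 / 10)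
    (hhk : σ.h ≤ σ.k₀) (hk₀ : σ.k₀ + 2 ≤ σ.k)
    (hΩ : ∀ i, σ.Ω (i + 1) ⊆ σ.Ω i) (hΩtop : σ.Ω σ.k ⊆ σ.Ω (σ.k + 1))
    (hα : σ.α = 1 / 12) (hβ0 : 0 ≤ σ.β) (hβ : σ.β ≤ 1 / 4) (hL₀ : 2 ≤ σ.L₀) (hL₀L : σ.L₀ ^ 2 ≤ ((F.P P.K).L : ℝ))
    (hB : 0 ≤ σ.O1 * σ.B₃ * σ.B₅ * σ.M ^ 5) (hδ : 0 ≤ σ.δ) (hM : 0 ≤ σ.M) (hdist : ∀ p, 0 ≤ σ.dist p)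
    {X' : ℝ} (hX' : ∀ j, 2 + X (D189OfRecord θ P σ) j ≤ X') (hsmall : X' * ((σ.L₀ ^ 2) ^ (σ.k - σ.k₀ - 1))⁻¹ ≤ 1 / 4)
    (hjEqK : ∀ m, σ.k₀ < m → m < σ.k → σ.Ω m \ σ.Ω (m + 1) ⊆ domK (D189OfRecord θ P σ))
    (hgeom : ∀ m, σ.k₀ < m → m < σ.k → ∀ p ∈ plaqsOf (σ.Ω m \ σ.Ω (m + 1)), 4 * ((m : ℝ) - σ.k₀) * σ.M ≤ σ.dist p)
    (hlarge : X (D189OfRecord θ P σ) σ.k * Real.exp (-(4 * σ.δ * σ.M)) ≤ σ.α)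
    (hbox : ∀ p ∈ plaqsOf (half (D189OfRecord θ P σ)), σ.boxOf p ∈ (↑σ.Xhalf : Set _) ∧ p ∈ plaqInside (cubeEnl (F.P P.K) σ.sh (σ.boxOf p) 1))
    (L91h : ∀ U, new189 (D189OfRecord θ P σ) U → ∀ p ∈ plaqsOf (half (D189OfRecord θ P σ)),
      Ineq191 (dist1 (plaqHol ((D189OfRecord θ P σ).Upp U) p)) (σ.devV'' U.1 p) σ.α ((((F.P P.K).L : ℝ) ^ σ.h)⁻¹)
        (epsOfRecord θ.ν (gOfRecord₁₀ F N θ P) σ.h) (E124 (epsOfRecord θ.ν (gOfRecord₁₀ F N θ P)) ((F.P P.K).L : ℝ) ((F.P P.K).eta σ.k) σ.k σ.h))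
    (L95 : ∀ U, new189 (D189OfRecord θ P σ) U → ∀ p ∈ plaqsOf (half (D189OfRecord θ P σ)),
      Ineq195 (σ.devV'' U.1 p) (dist1 (plaqHol ((D189OfRecord θ P σ).Uhalf U (σ.boxOf p)) p)) σ.α ((((F.P P.K).L : ℝ) ^ σ.h)⁻¹)
        (epsOfRecord θ.ν (gOfRecord₁₀ F N θ P) σ.h) (E124 (epsOfRecord θ.ν (gOfRecord₁₀ F N θ P)) ((F.P P.K).L : ℝ) ((F.P P.K).eta σ.k) σ.k σ.h))
    (L91 : ∀ U, new189 (D189OfRecord θ P σ) U → ∀ j, σ.h ≤ j → j ≤ σ.k → ∀ p ∈ plaqsOf (dom (D189OfRecord θ P σ) j),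
      Ineq191 (dist1 (plaqHol ((D189OfRecord θ P σ).Upp U) p)) (σ.dev97 U.1 p) σ.α ((((F.P P.K).L : ℝ) ^ j)⁻¹)
        (epsOfRecord θ.ν (gOfRecord₁₀ F N θ P) j) (E124 (epsOfRecord θ.ν (gOfRecord₁₀ F N θ P)) ((F.P P.K).L : ℝ) ((F.P P.K).eta σ.k) σ.k j))
    (L97 : ∀ U, new189 (D189OfRecord θ P σ) U → ∀ j, σ.h ≤ j → j ≤ σ.k → ∀ p ∈ plaqsOf (dom (D189OfRecord θ P σ) j),
      Ineq191 (σ.dev97 U.1 p) (σ.dev0 U.1 p) σ.α ((((F.P P.K).L : ℝ) ^ j)⁻¹) (epsOfRecord θ.ν (gOfRecord₁₀ F N θ P) j)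
        (E124 (epsOfRecord θ.ν (gOfRecord₁₀ F N θ P)) ((F.P P.K).L : ℝ) ((F.P P.K).eta σ.k) σ.k j))
    (L80 : ∀ U, new189 (D189OfRecord θ P σ) U → ∀ i, σ.h ≤ i → i ≤ σ.k → ∀ q ∈ plaqsOf (dom (D189OfRecord θ P σ) i),
      Ineq180 (σ.dev0 U.1 q) (epsOfRecord θ.ν (gOfRecord₁₀ F N θ P) σ.k) ((F.P P.K).eta σ.k) σ.B₃ σ.B₅ σ.M σ.δ (σ.dist q) σ.O1) :
    Claim189 (new189 (D189OfRecord θ P σ)) (chiPP (D189OfRecord θ P σ)) :=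
  claim189_D189OfRecord_of_inInterval P σ hhk hk₀ hΩ hΩtop hα hβ0 hβ hL₀ hL₀L hB hδ hM hdist hX' hsmall hjEqK hgeom hlarge (A₀_pos_of_admissible hθ).le S hβ₀ hε10
    (inInterval_gOfRecord₁₀_of_smallCouplings hfl hγ hsc hkK) (betaAlongHistory_le_of_betaSmoothBounded hfl hβs hkK) hbox L91h L95 L91 L97 L80

/-- **[III] (2.8), first member, FROM (2.6) ALONG ANY HISTORY IN THE WINDOW** — the cell's `B14FlowStep.flowIneq28_of_26` (print's *«β₀ > 0 can be chosen arbitrarily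
small»*: (2.6) with `β₁`, `(1+β₁)² ≦ 1+β₀` ⇒ (2.8) with `β₀`) read for def-R's thresholds: NO β-function input at all, only the window and the (2.6) relation (the DAG's
`flowControl` leaf `B14.FlowIneq26`). [cite: Balaban1988Convergent, (2.6) p.255, (2.8) p.256] -/
theorem epsOfRecord_flow28a_of_flowIneq26 (ν : Stage7Numerics) (hA₀ : 0 ≤ ν.A₀) {γ β' β₁ β₀ : ℝ} {L : ℕ} (S : SmallnessFor γ β' β₁ L ν.p₀)
    (hβ₁₀ : β₁ ≤ β₀) (hsq : (1 + β₁) ^ 2 ≤ 1 + β₀) {g : ℕ → ℝ} {K : ℕ} (hI : Step.InInterval γ K g) (h26 : B14.FlowIneq26 g β' β₁ K)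
    {m n : ℕ} (hmn : m < n) (hnK : n ≤ K) :
    epsOfRecord ν g n ≤ (1 + β₀) * Real.sqrt ((n : ℝ) - m) * epsOfRecord ν g m :=
  (B14FlowStep.flowIneq28_of_26 S hA₀ hβ₁₀ hsq hI h26 m n hmn hnK).1

/-- **THE (2.6) RELATION ALONG THE RUN IS THE RUN'S `flowControl` LEAF** (`B14.FlowIneq26 g βup β₀ K` — the located step T11.F of the DAG, an antecedent
`(ℓ.smallCouplings → ℓ.flowControl)` of `Dag.B14_main` already) at a world carrying the record's generated flow. [cite: Balaban1988Convergent, (2.6) p.255] -/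
theorem flowIneq26_gOfRecord₁₀_of_flowControl (hfl : (w.C P).flow = genFlow (betaOfRecord₁₀ F N θ) P.g0) (hfc : (leavesP w P).flowControl) :
    B14.FlowIneq26 (gOfRecord₁₀ F N θ P) w.βup w.β₀ P.K := by
  have hfc' : B14.FlowIneq26 (w.C P).flow.g w.βup w.β₀ P.K := hfc
  rw [hfl] at hfc'
  exact hfc'

/-- **Module 4's `hflow` FROM THE LEAVES `smallCouplings` AND `flowControl` of the same run** (no β-function leaf): situation step `σ.k ≦ P.K`, admissible `θ`,
`SmallnessFor θ.γ w.βup w.β₀ L p₀`, and the (2.8) constant `β₀` with `w.β₀ ≦ β₀`, `(1 + w.β₀)² ≦ 1 + β₀`. [cite: Balaban1988Convergent, (2.6) p.255, (2.8) p.256; Balaban1989LargeFieldI, p.199] -/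
theorem hflow_D189OfRecord_of_flowControl_leaves (hθ : θ.Admissible) (hfl : (w.C P).flow = genFlow (betaOfRecord₁₀ F N θ) P.g0) (hγ : w.γ ≤ θ.γ)
    (hsc : (leavesP w P).smallCouplings) (hfc : (leavesP w P).flowControl) (σ : Sit189 F N P.K) (hkK : σ.k ≤ P.K)
    {L : ℕ} (S : SmallnessFor θ.γ w.βup w.β₀ L θ.ν.p₀) {β₀ : ℝ} (hβ₁₀ : w.β₀ ≤ β₀) (hsq : (1 + w.β₀) ^ 2 ≤ 1 + β₀) :
    ∀ j, (D189OfRecord θ P σ).h ≤ j → j < (D189OfRecord θ P σ).k →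
      (D189OfRecord θ P σ).ε (D189OfRecord θ P σ).k ≤ (1 + β₀) * Real.sqrt (((D189OfRecord θ P σ).k - j : ℕ) : ℝ) * (D189OfRecord θ P σ).ε j := by
  intro j _ hjk
  have hjk' : j < σ.k := hjk
  show epsOfRecord θ.ν (gOfRecord₁₀ F N θ P) σ.k
    ≤ (1 + β₀) * Real.sqrt (((σ.k - j : ℕ) : ℝ)) * epsOfRecord θ.ν (gOfRecord₁₀ F N θ P) j
  rw [Nat.cast_sub hjk'.le]
  exact epsOfRecord_flow28a_of_flowIneq26 θ.ν (A₀_pos_of_admissible hθ).le S hβ₁₀ hsq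
    (inInterval_gOfRecord₁₀_of_smallCouplings hfl hγ hsc le_rfl) (flowIneq26_gOfRecord₁₀_of_flowControl hfl hfc) hjk' hkK

/-- **(1.89) AT THE PINNED LETTERS FROM THE LEAVES `smallCouplings` AND `flowControl`** — the β-free consumer shape of LOCATED (L1): a re-cut `Dag.B15_main` taking
`ℓ.smallCouplings` and `(ℓ.smallCouplings → ℓ.flowControl)` (as `Dag.B14_main` already does) hands the [IV] leaf exactly these. [cite: Balaban1989LargeFieldI, (1.89) p.198, pp.199–200; Balaban1988Convergent, (2.6) p.255, (2.8) p.256] -/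
theorem claim189_D189OfRecord_of_flowControl_leaves (hθ : θ.Admissible) (hfl : (w.C P).flow = genFlow (betaOfRecord₁₀ F N θ) P.g0) (hγ : w.γ ≤ θ.γ)
    (hsc : (leavesP w P).smallCouplings) (hfc : (leavesP w P).flowControl) (σ : Sit189 F N P.K) (hkK : σ.k ≤ P.K)
    {L : ℕ} (S : SmallnessFor θ.γ w.βup w.β₀ L θ.ν.p₀) {β₀ : ℝ} (hβ₁₀ : w.β₀ ≤ β₀) (hsq : (1 + w.β₀) ^ 2 ≤ 1 + β₀) (hβ₀0 : 0 ≤ β₀) (hβ₀ : β₀ ≤ 1 / 2)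
    (hε10 : θ.γ * p0Profile θ.ν.A₀ θ.ν.p₀ θ.γ ≤ 1 / 10)
    (hhk : σ.h ≤ σ.k₀) (hk₀ : σ.k₀ + 2 ≤ σ.k)
    (hΩ : ∀ i, σ.Ω (i + 1) ⊆ σ.Ω i) (hΩtop : σ.Ω σ.k ⊆ σ.Ω (σ.k + 1))
    (hα : σ.α = 1 / 12) (hβ0 : 0 ≤ σ.β) (hβ : σ.β ≤ 1 / 4) (hL₀ : 2 ≤ σ.L₀) (hL₀L : σ.L₀ ^ 2 ≤ ((F.P P.K).L : ℝ))
    (hB : 0 ≤ σ.O1 * σ.B₃ * σ.B₅ * σ.M ^ 5) (hδ : 0 ≤ σ.δ) (hM : 0 ≤ σ.M) (hdist : ∀ p, 0 ≤ σ.dist p)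
    {X' : ℝ} (hX' : ∀ j, 2 + X (D189OfRecord θ P σ) j ≤ X') (hsmall : X' * ((σ.L₀ ^ 2) ^ (σ.k - σ.k₀ - 1))⁻¹ ≤ 1 / 4)
    (hjEqK : ∀ m, σ.k₀ < m → m < σ.k → σ.Ω m \ σ.Ω (m + 1) ⊆ domK (D189OfRecord θ P σ))
    (hgeom : ∀ m, σ.k₀ < m → m < σ.k → ∀ p ∈ plaqsOf (σ.Ω m \ σ.Ω (m + 1)), 4 * ((m : ℝ) - σ.k₀) * σ.M ≤ σ.dist p)
    (hlarge : X (D189OfRecord θ P σ) σ.k * Real.exp (-(4 * σ.δ * σ.M)) ≤ σ.α)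
    (hbox : ∀ p ∈ plaqsOf (half (D189OfRecord θ P σ)), σ.boxOf p ∈ (↑σ.Xhalf : Set _) ∧ p ∈ plaqInside (cubeEnl (F.P P.K) σ.sh (σ.boxOf p) 1))
    (L91h : ∀ U, new189 (D189OfRecord θ P σ) U → ∀ p ∈ plaqsOf (half (D189OfRecord θ P σ)),
      Ineq191 (dist1 (plaqHol ((D189OfRecord θ P σ).Upp U) p)) (σ.devV'' U.1 p) σ.α ((((F.P P.K).L : ℝ) ^ σ.h)⁻¹)
        (epsOfRecord θ.ν (gOfRecord₁₀ F N θ P) σ.h) (E124 (epsOfRecord θ.ν (gOfRecord₁₀ F N θ P)) ((F.P P.K).L : ℝ) ((F.P P.K).eta σ.k) σ.k σ.h))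
    (L95 : ∀ U, new189 (D189OfRecord θ P σ) U → ∀ p ∈ plaqsOf (half (D189OfRecord θ P σ)),
      Ineq195 (σ.devV'' U.1 p) (dist1 (plaqHol ((D189OfRecord θ P σ).Uhalf U (σ.boxOf p)) p)) σ.α ((((F.P P.K).L : ℝ) ^ σ.h)⁻¹)
        (epsOfRecord θ.ν (gOfRecord₁₀ F N θ P) σ.h) (E124 (epsOfRecord θ.ν (gOfRecord₁₀ F N θ P)) ((F.P P.K).L : ℝ) ((F.P P.K).eta σ.k) σ.k σ.h))
    (L91 : ∀ U, new189 (D189OfRecord θ P σ) U → ∀ j, σ.h ≤ j → j ≤ σ.k → ∀ p ∈ plaqsOf (dom (D189OfRecord θ P σ) j),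
      Ineq191 (dist1 (plaqHol ((D189OfRecord θ P σ).Upp U) p)) (σ.dev97 U.1 p) σ.α ((((F.P P.K).L : ℝ) ^ j)⁻¹)
        (epsOfRecord θ.ν (gOfRecord₁₀ F N θ P) j) (E124 (epsOfRecord θ.ν (gOfRecord₁₀ F N θ P)) ((F.P P.K).L : ℝ) ((F.P P.K).eta σ.k) σ.k j))
    (L97 : ∀ U, new189 (D189OfRecord θ P σ) U → ∀ j, σ.h ≤ j → j ≤ σ.k → ∀ p ∈ plaqsOf (dom (D189OfRecord θ P σ) j),
      Ineq191 (σ.dev97 U.1 p) (σ.dev0 U.1 p) σ.α ((((F.P P.K).L : ℝ) ^ j)⁻¹) (epsOfRecord θ.ν (gOfRecord₁₀ F N θ P) j)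
        (E124 (epsOfRecord θ.ν (gOfRecord₁₀ F N θ P)) ((F.P P.K).L : ℝ) ((F.P P.K).eta σ.k) σ.k j))
    (L80 : ∀ U, new189 (D189OfRecord θ P σ) U → ∀ i, σ.h ≤ i → i ≤ σ.k → ∀ q ∈ plaqsOf (dom (D189OfRecord θ P σ) i),
      Ineq180 (σ.dev0 U.1 q) (epsOfRecord θ.ν (gOfRecord₁₀ F N θ P) σ.k) ((F.P P.K).eta σ.k) σ.B₃ σ.B₅ σ.M σ.δ (σ.dist q) σ.O1) :
    Claim189 (new189 (D189OfRecord θ P σ)) (chiPP (D189OfRecord θ P σ)) :=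
  claim189_assembly_of_flow_bdd (D189OfRecord θ P σ) hhk hk₀ hΩ hΩtop hα hβ0 hβ hL₀ hL₀L
    (eps_D189OfRecord_nonneg_of_inInterval P σ (A₀_pos_of_admissible hθ).le S.γ_lt_one.le (inInterval_gOfRecord₁₀_of_smallCouplings hfl hγ hsc hkK))
    (eps_D189OfRecord_le_of_inInterval P σ (A₀_pos_of_admissible hθ).le S hε10 (inInterval_gOfRecord₁₀_of_smallCouplings hfl hγ hsc hkK))
    hB hδ hM hdist hX' hsmall hjEqK hgeom hlarge hβ₀0 hβ₀ (hflow_D189OfRecord_of_flowControl_leaves hθ hfl hγ hsc hfc σ hkK S hβ₁₀ hsq) hbox L91h L95 L91 L97 L80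

end FromLeaves

end B15Claim189FlowAtRecord

end Literature.MathematicalPhysics.QuantumFieldTheory.Balaban1983to89

end
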